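import Mathlib.Topology.Algebra.ClopenNhdofOne
import Mathlib.Topology.MetricSpace.Contracting
import Mathlib.NumberTheory.NumberField.Completion.FinitePlace
import Literature.NumberTheory.GaloisRepresentations.ArtinRestriction
import Literature.NumberTheory.GaloisRepresentations.SerreTrickArtinLift
import HarnessLib

/-!
# The twisting character of Serre's trick over `ℚ`: an explicit Kummer character, and Allen's
# Lemma 87 (Galois side, `p = 2`) over `ℚ` without hypotheses

Theorems only (no definition of a notion, no named fact; D-0026), written by the seat of the
named fact `Literature.NumberTheory.Automorphic.Allen2014_modularity_nearlyOrdinaryDihedral_Q`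
(P. B. Allen, Compositio Math. 150 (2014) = arXiv:1301.1113).  The file DISCHARGES, for the base
field `K = ℚ`, the hypothesis `hAT` of
`FramedGaloisRep.exists_odd_artinLift_diagonal_of_isSolvable_two_of_exists_twistChar`
(`SerreTrickArtinLift`), i.e. the number-theoretic input of Serre's trick in the proof of Allen's
Lemma 87 (OrdinaryLift), arXiv:1301.1113 p. 70:

> "By [ArtinTate, X Theorem 5], there is a character `ξ : G_L → ℚ̄ˣ` of order either two or
> four, such that `ξ` [is] nontrivial at each `{σ₁, …, σ_k}` and trivial at each
> `{σ'₁, …, σ'_k}` as well as at every place above `2`."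

Over `ℚ` (one real place, so `k ≤ 1`) no Grunwald–Wang theorem is needed: for the quadratic field
`L = ℚ̄^{Hm} = ℚ(s)`, `s² = d ∈ ℤ`, cut out by the open index-two subgroup `Hm ≤ Γ_ℚ`, the
character `ξ(g) = g(β)/β = ±1` of `G_L = Hm`, where `β² = α := 1 + 4 N s` with `N = N(v) ∈ v`,
has order two (so it is trivial modulo the maximal ideal of `ℤ̄₂`), takes the values `-1` and `+1`
at the two complex conjugations `c` and `c₀⁻¹ c c₀` of `Hm` above the real place when `L` is real
(the sign of `s` is chosen so that `α < 0 < ᾱ` under the reference complex embedding), and is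
trivial on the decomposition groups at `v` inside `Hm`, because `α ≡ 1 (mod 4N)` is a square in
`L_w` for `w ∣ v`: the square root `1 + 2z`, `z = a + b s`, is produced by the ultrametric
contraction `(a, b) ↦ (-(a² + b² d), N - 2ab)` of the closed ball of radius `‖N‖_v < 1` in
`ℚ_v × ℚ_v` (`exists_eq_neg_sq_add_and_eq_sub_two_mul`; no Hensel lemma in extensions of `ℚ₂`
is required).

## Main results (all proved)

* `exists_eq_neg_sq_add_and_eq_sub_two_mul` — the two-variable contraction in a complete
  ultrametric field.
* `absGaloisRestrict_smul_eq_self_of_sq_eq_one_add` — LOCAL TRIVIALITY: for a number field `K`, a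
  finite place `v`, `N ∈ v`, `t² = d ∈ ℤ` and `γ² = 1 + 4 N t` in `K̄`, every `σ ∈ Γ_{K_v}` whose
  restriction fixes `t` fixes `γ`.
* `exists_smul_eq_neg_of_forall_mul_mem` — for an open subgroup `Hm ≤ Γ_K` (char. `0`) with
  `c₀ ∉ Hm` and `Γ_K ∖ Hm · Γ_K ∖ Hm ⊆ Hm`: an `s ∈ K̄`, `s ≠ 0`, `s² ∈ K`, fixed by `Hm` with
  `c₀ s = -s` (so `K̄^{Hm} = K(s)`); `exists_smul_eq_neg_of_forall_mul_mem_rat` — over `ℚ` with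
  `s² ∈ ℤ`.
* `exists_normal_isOpen_forall_smul_eq` — an open normal subgroup of `Γ_K` inside `Hm` fixing a
  given `β`.
* `exists_twistChar_rat` — **`hAT` for `K = ℚ`**, verbatim the hypothesis of
  `FramedGaloisRep.exists_odd_artinLift_diagonal_of_isSolvable_two_of_exists_twistChar`.
* `FramedGaloisRep.exists_odd_artinLift_diagonal_of_isSolvable_two_rat`,
  `FramedGaloisRep.exists_odd_artinLift_diagonal_of_isOrdinaryOfWeightAt_two_rat` — **Allen's
  Lemma 87, Galois side, at `p = 2` over `ℚ`, unconditionally**: for `ρ : Γ_ℚ → GL₂(ℚ̄₂)`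
  residually absolutely irreducible with solvable residual image (hypothesis (4) of the
  Introduction Theorem) and a triangular form of `ρ̄|_{Γ_{ℚ_v}}` (resp. `ρ` ordinary of some
  weight at `v`, hypothesis (2)), an ODD continuous Artin lift `ρ₁` of `ρ̄` with integral model,
  open kernel, root-of-unity entries and `ρ₁|_{Γ_{ℚ_v}} ≅ χ'_v ⊕ χ_v`, `χ_v` lifting `χ̄_v` —
  "the lift `ρ₁` is totally odd … `ρ₁|_{G_v} ≅ (χ'_v 0 ; 0 χ_v)`" (Allen p. 70).
* `FramedGaloisRep.exists_odd_monomial_artinLift_diagonal_of_isSolvable_two_of_exists_twistChar`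
  (any number field, modulo `hAT`) and its `…_rat` corollaries — the same with the INDUCED
  structure `ρ₁ = Ind_{G_L}^{G_K} ψ` exported (the open index-two `Hm = G_L ⊇ ker ρ̄` with respect
  to which the integral model of `ρ₁` is monomial), the shape consumed by the automorphic half
  of Lemma 87 (theta series of `L`).
* `FramedGaloisRep.exists_odd_monomial_artinLift_diagonal_oddOrder_of_isSolvable_two_of_exists_twistChar`
  and its `…_rat` corollaries — the same with, in addition, an ODD `n₀` such that `χ'_v, χ_v`
  take values in `μ_{n₀}` on `Γ_{K_v} ∩ G_L` (there `ξ` is trivial and `ρ₁ = Ind χ` is the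
  Teichmüller lift, whose entries are odd-order roots of unity) — the datum which, at `p = 2`,
  makes `ρ₁` unramified at `v` when the inertia group of `K_v` lands in `G_L` (odd-order abelian
  characters of `Γ_{ℚ₂}` are unramified, `TameCharacterInertiaOrder`).

## References

* P. B. Allen, Compositio Math. 150 (2014) 1235–1346, Lemma 87 (= arXiv:1301.1113, §5.1.1,
  pp. 69–70). [Allen2014]
* E. Artin, J. Tate, *Class Field Theory*, Ch. X, Thm. 5 (the general input, replaced over `ℚ` by
  the explicit Kummer character above).
* J.-P. Serre, *Modular forms of weight one and Galois representations* (Durham 1975), §8.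
-/

noncomputable section

open scoped MatrixGroups NumberField
open Matrix IsLocalRing IsDedekindDomain Field

namespace Literature.NumberTheory.GaloisRepresentations

/-! ### A two-variable ultrametric contraction -/

section Contraction

variable {F : Type*} [NormedField F] [IsUltrametricDist F] [CompleteSpace F]

/-- **Square roots of `1 + 4 N s` by contraction.**  In a complete ultrametric field, for
`‖d‖ ≤ 1` and `‖N‖ < 1` the map `(a, b) ↦ (-(a² + b² d), N - 2ab)` is a contraction of the closed
ball of radius `‖N‖` of `F × F`, so it has a fixed point: `a = -(a² + b² d)`, `b = N - 2ab`.
(Then `z = a + b s`, `s² = d`, satisfies `z + z² = N s`, i.e. `(1 + 2z)² = 1 + 4 N s`.)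
[folklore] -/
theorem exists_eq_neg_sq_add_and_eq_sub_two_mul {d N : F} (hd : ‖d‖ ≤ 1) (hN : ‖N‖ < 1) :
    ∃ a b : F, a = -(a ^ 2 + b ^ 2 * d) ∧ b = N - 2 * a * b := by
  have hsub : ∀ x y : F, ‖x - y‖ ≤ max ‖x‖ ‖y‖ := fun x y => by
    simpa only [sub_eq_add_neg, norm_neg] using IsUltrametricDist.norm_add_le_max x (-y)
  have h2 : ‖(2 : F)‖ ≤ 1 := by simpa using IsUltrametricDist.norm_natCast_le_one F 2
  set r : ℝ := ‖N‖ with hr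
  have hr0 : 0 ≤ r := norm_nonneg N
  have hr1 : r < 1 := hN
  have hrr : r * r ≤ r := by nlinarith
  -- the map and the ball
  set T : F × F → F × F := fun p => (-(p.1 ^ 2 + p.2 ^ 2 * d), N - 2 * p.1 * p.2) with hT
  set s : Set (F × F) := Metric.closedBall 0 r with hs
  have hmem : ∀ p : F × F, p ∈ s ↔ ‖p.1‖ ≤ r ∧ ‖p.2‖ ≤ r := fun p => by
    rw [hs, Metric.mem_closedBall, dist_zero_right, Prod.norm_def, max_le_iff]
  -- norm estimates
  have hprod : ∀ x y : F, ‖x‖ ≤ r → ‖y‖ ≤ r → ‖x * y‖ ≤ r := fun x y hx hy => by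
    rw [norm_mul]
    exact (mul_le_mul hx hy (norm_nonneg _) hr0).trans hrr
  have hmaps : Set.MapsTo T s s := by
    intro p hp
    obtain ⟨ha, hb⟩ := (hmem p).1 hp
    refine (hmem _).2 ⟨?_, ?_⟩
    · change ‖-(p.1 ^ 2 + p.2 ^ 2 * d)‖ ≤ r
      rw [norm_neg]
      refine (IsUltrametricDist.norm_add_le_max _ _).trans (max_le ?_ ?_)
      · rw [pow_two]
        exact hprod _ _ ha ha
      · rw [norm_mul, pow_two]
        calc ‖p.2 * p.2‖ * ‖d‖ ≤ r * 1 :=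
              mul_le_mul (hprod _ _ hb hb) hd (norm_nonneg _) hr0
          _ = r := mul_one r
    · change ‖N - 2 * p.1 * p.2‖ ≤ r
      refine (hsub _ _).trans (max_le le_rfl ?_)
      rw [mul_assoc, norm_mul]
      calc ‖(2 : F)‖ * ‖p.1 * p.2‖ ≤ 1 * r :=
            mul_le_mul h2 (hprod _ _ ha hb) (norm_nonneg _) zero_le_one
        _ = r := one_mul r
  -- the Lipschitz estimate
  have hdist : ∀ p q : F × F, p ∈ s → q ∈ s → dist (T p) (T q) ≤ r * dist p q := by
    intro p q hp hq
    obtain ⟨ha, hb⟩ := (hmem p).1 hp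
    obtain ⟨ha', hb'⟩ := (hmem q).1 hq
    rw [Prod.dist_eq, Prod.dist_eq, dist_eq_norm, dist_eq_norm, dist_eq_norm, dist_eq_norm]
    have hmax0 : 0 ≤ max ‖p.1 - q.1‖ ‖p.2 - q.2‖ := le_max_of_le_left (norm_nonneg _)
    refine max_le ?_ ?_
    · -- first component: `(q₁ - p₁)(q₁ + p₁) + (q₂ - p₂)(q₂ + p₂) d`
      have e : -(p.1 ^ 2 + p.2 ^ 2 * d) - -(q.1 ^ 2 + q.2 ^ 2 * d) =
          (q.1 - p.1) * (q.1 + p.1) + (q.2 - p.2) * (q.2 + p.2) * d := by ring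
      change ‖-(p.1 ^ 2 + p.2 ^ 2 * d) - -(q.1 ^ 2 + q.2 ^ 2 * d)‖ ≤ _
      rw [e]
      refine (IsUltrametricDist.norm_add_le_max _ _).trans (max_le ?_ ?_)
      · rw [norm_mul, ← norm_neg (q.1 - p.1), neg_sub]
        have h1 : ‖q.1 + p.1‖ ≤ r :=
          (IsUltrametricDist.norm_add_le_max _ _).trans (max_le ha' ha)
        have h1' : ‖p.1 - q.1‖ * ‖q.1 + p.1‖ ≤ max ‖p.1 - q.1‖ ‖p.2 - q.2‖ * r :=
          mul_le_mul (le_max_left _ _) h1 (norm_nonneg _) hmax0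
        rw [mul_comm r]
        exact h1'
      · rw [norm_mul, norm_mul, ← norm_neg (q.2 - p.2), neg_sub]
        have h1 : ‖q.2 + p.2‖ ≤ r :=
          (IsUltrametricDist.norm_add_le_max _ _).trans (max_le hb' hb)
        have h1' : ‖p.2 - q.2‖ * ‖q.2 + p.2‖ * ‖d‖ ≤ max ‖p.1 - q.1‖ ‖p.2 - q.2‖ * r * 1 :=
          mul_le_mul (mul_le_mul (le_max_right _ _) h1 (norm_nonneg _) hmax0) hd
            (norm_nonneg _) (mul_nonneg hmax0 hr0)
        rw [mul_one, mul_comm _ r] at h1'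
        exact h1'
    · -- second component: `2 (q₁ (q₂ - p₂) + (q₁ - p₁) p₂)`
      have e : N - 2 * p.1 * p.2 - (N - 2 * q.1 * q.2) =
          2 * (q.1 * (q.2 - p.2) + (q.1 - p.1) * p.2) := by ring
      change ‖N - 2 * p.1 * p.2 - (N - 2 * q.1 * q.2)‖ ≤ _
      rw [e, norm_mul]
      have hin : ‖q.1 * (q.2 - p.2) + (q.1 - p.1) * p.2‖ ≤ r * max ‖p.1 - q.1‖ ‖p.2 - q.2‖ := by
        refine (IsUltrametricDist.norm_add_le_max _ _).trans (max_le ?_ ?_)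
        · rw [norm_mul, ← norm_neg (q.2 - p.2), neg_sub]
          exact mul_le_mul ha' (le_max_right _ _) (norm_nonneg _) hr0
        · rw [norm_mul, ← norm_neg (q.1 - p.1), neg_sub, mul_comm]
          exact mul_le_mul hb (le_max_left _ _) (norm_nonneg _) hr0
      have hfin : ‖(2 : F)‖ * ‖q.1 * (q.2 - p.2) + (q.1 - p.1) * p.2‖ ≤
          1 * (r * max ‖p.1 - q.1‖ ‖p.2 - q.2‖) :=
        mul_le_mul h2 hin (norm_nonneg _) zero_le_one
      rw [one_mul] at hfin
      exact hfin
  have hK : ContractingWith ‖N‖₊ (hmaps.restrict T s s) := by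
    refine ⟨by exact_mod_cast hN, LipschitzWith.of_dist_le_mul fun x y => ?_⟩
    rw [Subtype.dist_eq, Subtype.dist_eq, Set.MapsTo.val_restrict_apply,
      Set.MapsTo.val_restrict_apply, coe_nnnorm]
    exact hdist x.1 y.1 x.2 y.2
  obtain ⟨y, -, hfix, -⟩ := hK.exists_fixedPoint' Metric.isClosed_closedBall.isComplete hmaps
    (x := 0) (Metric.mem_closedBall_self hr0) (edist_ne_top _ _)
  refine ⟨y.1, y.2, ?_, ?_⟩
  · have e := congrArg Prod.fst hfix
    exact e.symm
  · have e := congrArg Prod.snd hfix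
    exact e.symm

end Contraction

/-! ### Local triviality: `1 + 4 N t` is a square fixed by `Γ_{K_v} ∩ G_L` -/

section Local

open NumberField

variable {K : Type*} [Field K] [NumberField K]

/-- **Local triviality of the Kummer character at `v`.**  Let `v` be a finite place of the
number field `K`, `N` a natural number in `v`, `t ∈ K̄` with `t² = d ∈ ℤ` and `γ ∈ K̄` with
`γ² = 1 + 4 N t`.  If `σ ∈ Γ_{K_v}` fixes `t` (through the restriction `Γ_{K_v} → Γ_K` and the
chosen `K̄ → \overline{K_v}`), then `σ` fixes `γ`: in `\overline{K_v}` one has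
`1 + 4 N t = (1 + 2z)²` with `z = a + b t`, `a, b ∈ K_v` the fixed point of
`exists_eq_neg_sq_add_and_eq_sub_two_mul` (`‖d‖_v ≤ 1`, `‖N‖_v < 1`), and `σ` fixes `K_v` and
`t`.  ("`ξ` is trivial at every place above `2`", for `ξ(g) = g(γ)/γ`.)
[cite: Allen2014, Lemma 87 (arXiv:1301.1113, §5.1.1, p. 70)] -/
theorem absGaloisRestrict_smul_eq_self_of_sq_eq_one_add (v : HeightOneSpectrum (𝓞 K)) {N : ℕ}
    (hN : (N : 𝓞 K) ∈ v.asIdeal) {d : ℤ} {t γ : AlgebraicClosure K}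
    (ht : t ^ 2 = (d : AlgebraicClosure K))
    (hγ : γ ^ 2 = 1 + 4 * (N : AlgebraicClosure K) * t)
    (σ : absoluteGaloisGroup (v.adicCompletion K))
    (hσ : absGaloisRestrict K (v.adicCompletion K) σ • t = t) :
    absGaloisRestrict K (v.adicCompletion K) σ • γ = γ := by
  -- norms in `K_v`
  have hdn : ‖((d : ℤ) : v.adicCompletion K)‖ ≤ 1 :=
    IsUltrametricDist.norm_intCast_le_one (v.adicCompletion K) d
  have hNn : ‖((N : ℕ) : v.adicCompletion K)‖ < 1 := by
    have h := (FinitePlace.norm_lt_one_iff_mem (K := K) (v := v) (N : 𝓞 K)).mpr hN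
    rwa [map_natCast, map_natCast] at h
  obtain ⟨a, b, ha, hb⟩ := exists_eq_neg_sq_add_and_eq_sub_two_mul hdn hNn
  -- in `Ω = \overline{K_v}`
  set e := absClosureEmbedding K (v.adicCompletion K) with he
  set A : AlgebraicClosure (v.adicCompletion K) :=
    algebraMap (v.adicCompletion K) (AlgebraicClosure (v.adicCompletion K)) a with hA
  set B : AlgebraicClosure (v.adicCompletion K) :=
    algebraMap (v.adicCompletion K) (AlgebraicClosure (v.adicCompletion K)) b with hB
  set S : AlgebraicClosure (v.adicCompletion K) := e t with hS
  have hS2 : S ^ 2 = (d : AlgebraicClosure (v.adicCompletion K)) := by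
    rw [hS, ← map_pow, ht, map_intCast]
  have hA' : A = -(A ^ 2 + B ^ 2 * (d : AlgebraicClosure (v.adicCompletion K))) := by
    have h := congrArg (algebraMap (v.adicCompletion K) (AlgebraicClosure (v.adicCompletion K))) ha
    rwa [map_neg, map_add, map_pow, map_mul, map_pow, map_intCast] at h
  have hB' : B = (N : AlgebraicClosure (v.adicCompletion K)) - 2 * A * B := by
    have h := congrArg (algebraMap (v.adicCompletion K) (AlgebraicClosure (v.adicCompletion K))) hb
    rwa [map_sub, map_mul, map_mul, map_natCast, map_ofNat] at h
  set z : AlgebraicClosure (v.adicCompletion K) := A + B * S with hz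
  have hzz : z + z ^ 2 = (N : AlgebraicClosure (v.adicCompletion K)) * S := by
    rw [hz]
    linear_combination hA' + S * hB' + B ^ 2 * hS2
  have hsq : (e γ) ^ 2 = (1 + 2 * z) ^ 2 := by
    rw [← map_pow, hγ, map_add, map_one, map_mul, map_mul, map_ofNat, map_natCast, ← hS]
    linear_combination (-4 : AlgebraicClosure (v.adicCompletion K)) * hzz
  -- `σ` fixes `z`
  have hφ : ∀ x : AlgebraicClosure (v.adicCompletion K),
      σ • x = absoluteGaloisGroup.toAlgEquiv (v.adicCompletion K) σ x := fun x => rfl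
  have hσS : σ • S = S := by
    rw [hS, ← absGaloisRestrict_apply_smul, hσ]
  have hσz : σ • (1 + 2 * z) = 1 + 2 * z := by
    have hσA : σ • A = A := by rw [hφ, hA, AlgEquiv.commutes]
    have hσB : σ • B = B := by rw [hφ, hB, AlgEquiv.commutes]
    rw [hφ] at hσA hσB hσS
    rw [hφ, map_add, map_one, map_mul, map_ofNat, hz, map_add, map_mul, hσA, hσB, hσS]
  -- conclude
  have hfix : σ • e γ = e γ := by
    rcases sq_eq_sq_iff_eq_or_eq_neg.1 hsq with h | h
    · rw [h, hσz]
    · rw [h, smul_neg, hσz]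
  apply e.toRingHom.injective
  change e (absGaloisRestrict K (v.adicCompletion K) σ • γ) = e γ
  rw [absGaloisRestrict_apply_smul, hfix]

end Local

/-! ### The quadratic field of an open index-two subgroup of `Γ_K` -/

section IndexTwo

variable {K : Type*} [Field K]

/-- For `s ∈ K̄` with `s² ∈ ℤ`, every `g ∈ Γ_K` maps `s` to `± s`. [folklore] -/
theorem smul_eq_self_or_eq_neg_of_sq_eq_intCast (g : absoluteGaloisGroup K)
    {s : AlgebraicClosure K} {d : ℤ} (hs : s ^ 2 = (d : AlgebraicClosure K)) :
    g • s = s ∨ g • s = -s := by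
  apply sq_eq_sq_iff_eq_or_eq_neg.1
  rw [← smul_pow', hs, absoluteGaloisGroup.smul_def, map_intCast]

variable [CharZero K]

/-- **The anti-invariant generator of the quadratic field `K̄^{Hm}`.**  Let `Hm ≤ Γ_K` be an open
subgroup, `c₀ ∉ Hm`, such that the product of two elements off `Hm` lies in `Hm` (so `Hm` has
index two).  Then there is `s ∈ K̄`, `s ≠ 0`, with `s² ∈ K`, fixed by `Hm` and with
`c₀ s = -s`: for `θ ∈ L = K̄^{Hm}` not fixed by `c₀` (Krull: `Gal(K̄/L) = Hm ∌ c₀`) take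
`s = θ - c₀ θ`; `s²` is fixed by `Hm` and `c₀`, hence by `Γ_K`, hence lies in `K`.  (`L = K(s)`,
the Kummer generator of the quadratic field.) [folklore] -/
theorem exists_smul_eq_neg_of_forall_mul_mem (Hm : Subgroup (absoluteGaloisGroup K))
    (c₀ : absoluteGaloisGroup K) (hopen : IsOpen (Hm : Set (absoluteGaloisGroup K)))
    (hc₀ : c₀ ∉ Hm) (h2 : ∀ g g', g ∉ Hm → g' ∉ Hm → g * g' ∈ Hm) :
    ∃ (s : AlgebraicClosure K) (D : K), s ≠ 0 ∧ s ^ 2 = algebraMap K (AlgebraicClosure K) D ∧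
      c₀ • s = -s ∧ ∀ g ∈ Hm, g • s = s := by
  set L : IntermediateField K (AlgebraicClosure K) := IntermediateField.fixedField Hm with hL
  have hfix : (L.fixingSubgroup : Subgroup (absoluteGaloisGroup K)) = Hm :=
    fixingSubgroup_fixedField_of_isOpen Hm hopen
  -- `c₀` moves some `θ ∈ L`
  obtain ⟨θ, hθL, hθc⟩ : ∃ θ : AlgebraicClosure K, θ ∈ L ∧ c₀ • θ ≠ θ := by
    by_contra h
    push Not at h
    have hmem := (mem_fixingSubgroup_iff_forall_smul L c₀).2 fun x => h x x.2
    rw [hfix] at hmem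
    exact hc₀ hmem
  have hHθ : ∀ g ∈ Hm, g • θ = θ := fun g hg => hθL ⟨g, hg⟩
  have hc₀inv : c₀⁻¹ ∉ Hm := fun h => hc₀ (by simpa using Hm.inv_mem h)
  set s := θ - c₀ • θ with hs
  have hsH : ∀ g ∈ Hm, g • s = s := by
    intro g hg
    have hmem : c₀⁻¹ * g * c₀ ∈ Hm := by
      have h1 : c₀⁻¹ * g ∉ Hm := fun h => hc₀inv (by simpa using Hm.mul_mem h (Hm.inv_mem hg))
      exact h2 _ _ h1 hc₀
    have e : g * c₀ = c₀ * (c₀⁻¹ * g * c₀) := by group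
    rw [hs, smul_sub, hHθ g hg, ← mul_smul, e, mul_smul, hHθ _ hmem]
  have hsc : c₀ • s = -s := by
    rw [hs, smul_sub, ← mul_smul, hHθ _ (h2 _ _ hc₀ hc₀), neg_sub]
  have hs0 : s ≠ 0 := fun h => hθc (by rw [hs, sub_eq_zero] at h; exact h.symm)
  -- `s²` is `Γ_K`-invariant
  have hsq : ∀ g : absoluteGaloisGroup K, g • s ^ 2 = s ^ 2 := by
    intro g
    rw [smul_pow']
    by_cases hg : g ∈ Hm
    · rw [hsH g hg]
    · have e : g = c₀ * (c₀⁻¹ * g) := by group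
      rw [e, mul_smul, hsH _ (h2 _ _ hc₀inv hg), hsc, neg_sq]
  obtain ⟨D, hD⟩ : s ^ 2 ∈ Set.range (algebraMap K (AlgebraicClosure K)) := by
    rw [InfiniteGalois.mem_range_algebraMap_iff_fixed]
    intro f
    exact hsq ((absoluteGaloisGroup.toAlgEquiv K).symm f)
  exact ⟨s, D, hs0, hD.symm, hsc, hsH⟩

/-- Membership in `Hm` is "fixing `s`", for `s` as in `exists_smul_eq_neg_of_forall_mul_mem`.
[folklore] -/
theorem mem_iff_smul_eq_self_of_smul_eq_neg {Hm : Subgroup (absoluteGaloisGroup K)}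
    {c₀ : absoluteGaloisGroup K} (hc₀ : c₀ ∉ Hm)
    (h2 : ∀ g g', g ∉ Hm → g' ∉ Hm → g * g' ∈ Hm) {s : AlgebraicClosure K} (hs0 : s ≠ 0)
    (hsc : c₀ • s = -s) (hsH : ∀ g ∈ Hm, g • s = s) (g : absoluteGaloisGroup K) :
    g ∈ Hm ↔ g • s = s := by
  refine ⟨hsH g, fun hg => by_contra fun hgH => hs0 ?_⟩
  have hc₀inv : c₀⁻¹ ∉ Hm := fun h => hc₀ (by simpa using Hm.inv_mem h)
  have e : g = c₀ * (c₀⁻¹ * g) := by group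
  have h : g • s = -s := by rw [e, mul_smul, hsH _ (h2 _ _ hc₀inv hgH), hsc]
  rw [hg] at h
  have h2s : (2 : AlgebraicClosure K) * s = 0 := by linear_combination h
  simpa using h2s

omit [CharZero K] in
/-- Off `Hm`, every element acts on `s` by `-1` (notation of
`exists_smul_eq_neg_of_forall_mul_mem`). [folklore] -/
theorem smul_eq_neg_of_notMem {Hm : Subgroup (absoluteGaloisGroup K)}
    {c₀ : absoluteGaloisGroup K} (hc₀ : c₀ ∉ Hm)
    (h2 : ∀ g g', g ∉ Hm → g' ∉ Hm → g * g' ∈ Hm) {s : AlgebraicClosure K}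
    (hsc : c₀ • s = -s) (hsH : ∀ g ∈ Hm, g • s = s) {g : absoluteGaloisGroup K} (hg : g ∉ Hm) :
    g • s = -s := by
  have hc₀inv : c₀⁻¹ ∉ Hm := fun h => hc₀ (by simpa using Hm.inv_mem h)
  have e : g = c₀ * (c₀⁻¹ * g) := by group
  rw [e, mul_smul, hsH _ (h2 _ _ hc₀inv hg), hsc]

/-- **An open normal subgroup of `Γ_K` inside `Hm` fixing `β`** (profiniteness of `Γ_K`:
Mathlib's `ProfiniteGrp.exist_openNormalSubgroup_sub_open_nhds_of_one` applied to
`Hm ∩ Gal(K̄/K(β))`). [folklore] -/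
theorem exists_normal_isOpen_forall_smul_eq (Hm : Subgroup (absoluteGaloisGroup K))
    (hopen : IsOpen (Hm : Set (absoluteGaloisGroup K))) (β : AlgebraicClosure K) :
    ∃ N : Subgroup (absoluteGaloisGroup K), N.Normal ∧ IsOpen (N : Set (absoluteGaloisGroup K)) ∧
      ∀ g ∈ N, g ∈ Hm ∧ g • β = β := by
  haveI : FiniteDimensional K (IntermediateField.adjoin K {β}) :=
    IntermediateField.adjoin.finiteDimensional (Algebra.IsIntegral.isIntegral β)
  let W : Subgroup (absoluteGaloisGroup K) := (IntermediateField.adjoin K {β}).fixingSubgroup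
  have hWo : IsOpen (W : Set (absoluteGaloisGroup K)) :=
    IntermediateField.fixingSubgroup_isOpen (IntermediateField.adjoin K {β})
  set U : Set (absoluteGaloisGroup K) := (Hm : Set (absoluteGaloisGroup K)) ∩
    (W : Set (absoluteGaloisGroup K)) with hU
  have hUo : IsOpen U := hopen.inter hWo
  have h1 : (1 : absoluteGaloisGroup K) ∈ U := ⟨Hm.one_mem, W.one_mem⟩
  obtain ⟨N, hN⟩ := ProfiniteGrp.exist_openNormalSubgroup_sub_open_nhds_of_one hUo h1
  refine ⟨N, N.isNormal', N.isOpen', fun g hg => ?_⟩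
  obtain ⟨hgH, hgβ⟩ := hN hg
  have hgW : g ∈ W := hgβ
  exact ⟨hgH, (mem_fixingSubgroup_iff_forall_smul (IntermediateField.adjoin K {β}) g).1 hgW
    ⟨β, IntermediateField.mem_adjoin_simple_self K β⟩⟩

end IndexTwo

/-! ### Over `ℚ`: integral generator, signs at the real place -/

section Rat

/-- `exists_smul_eq_neg_of_forall_mul_mem` over `ℚ` with an INTEGRAL square: `s² = d ∈ ℤ`
(clear the denominator of `s² ∈ ℚ`). [folklore] -/
theorem exists_smul_eq_neg_of_forall_mul_mem_rat (Hm : Subgroup (absoluteGaloisGroup ℚ))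
    (c₀ : absoluteGaloisGroup ℚ) (hopen : IsOpen (Hm : Set (absoluteGaloisGroup ℚ)))
    (hc₀ : c₀ ∉ Hm) (h2 : ∀ g g', g ∉ Hm → g' ∉ Hm → g * g' ∈ Hm) :
    ∃ (s : AlgebraicClosure ℚ) (d : ℤ), s ≠ 0 ∧ s ^ 2 = (d : AlgebraicClosure ℚ) ∧
      c₀ • s = -s ∧ ∀ g ∈ Hm, g • s = s := by
  obtain ⟨s, D, hs0, hsD, hsc, hsH⟩ := exists_smul_eq_neg_of_forall_mul_mem Hm c₀ hopen hc₀ h2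
  have hsD' : s ^ 2 = (D : AlgebraicClosure ℚ) := by rw [hsD, eq_ratCast]
  have hnum : (D : AlgebraicClosure ℚ) * (D.den : AlgebraicClosure ℚ) =
      (D.num : AlgebraicClosure ℚ) := by
    have h := Rat.mul_den_eq_num D
    exact_mod_cast congrArg (fun x : ℚ => (x : AlgebraicClosure ℚ)) h
  have hnat : ∀ g : absoluteGaloisGroup ℚ,
      g • (D.den : AlgebraicClosure ℚ) = (D.den : AlgebraicClosure ℚ) := fun g => by
    rw [absoluteGaloisGroup.smul_def, map_natCast]
  refine ⟨(D.den : AlgebraicClosure ℚ) * s, D.den * D.num, ?_, ?_, ?_, fun g hg => ?_⟩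
  · exact mul_ne_zero (Nat.cast_ne_zero.2 D.den_nz) hs0
  · rw [mul_pow, hsD']
    push_cast
    rw [← hnum]
    ring
  · rw [smul_mul', hnat, hsc, mul_neg]
  · rw [smul_mul', hnat, hsH g hg]

/-- A complex number whose square is a positive real is real. [folklore] -/
theorem complex_conj_eq_self_of_sq_eq_ofReal {z : ℂ} {r : ℝ} (hr : 0 < r)
    (hz : z ^ 2 = (r : ℂ)) : starRingEnd ℂ z = z := by
  rw [Complex.conj_eq_iff_im]
  have him : (z ^ 2).im = 0 := by rw [hz, Complex.ofReal_im]
  have hre : (z ^ 2).re = r := by rw [hz, Complex.ofReal_re]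
  rw [pow_two, Complex.mul_im] at him
  rw [pow_two, Complex.mul_re] at hre
  by_contra hne
  have h0 : z.re = 0 := by
    have h2 : z.re * z.im = 0 := by linarith
    exact (mul_eq_zero.1 h2).resolve_right hne
  rw [h0] at hre
  nlinarith [mul_self_nonneg z.im]

/-- **Choosing the sign of `s` at the real place.**  Given `s₁` as in
`exists_smul_eq_neg_of_forall_mul_mem_rat` and a complex conjugation `c` of `Γ_ℚ` for an
embedding `ι : ℚ̄ → ℂ` (`ι (c x) = conj (ι x)`): if `c ∈ Hm` then `ι s₁` is real with
`(ι s₁)² = d ≥ 1`, and replacing `s₁` by `-s₁` if necessary, `ι s ≤ -1`. [folklore] -/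
theorem exists_generator_ofReal_le_neg_one {Hm : Subgroup (absoluteGaloisGroup ℚ)}
    {c₀ : absoluteGaloisGroup ℚ} {s₁ : AlgebraicClosure ℚ} {d : ℤ} (hs₁0 : s₁ ≠ 0)
    (hs₁d : s₁ ^ 2 = (d : AlgebraicClosure ℚ)) (hs₁c : c₀ • s₁ = -s₁)
    (hs₁H : ∀ g ∈ Hm, g • s₁ = s₁) {c : absoluteGaloisGroup ℚ} {ι : AlgebraicClosure ℚ →+* ℂ}
    (hιc : ∀ x, ι (c • x) = starRingEnd ℂ (ι x)) :
    ∃ s : AlgebraicClosure ℚ, s ≠ 0 ∧ s ^ 2 = (d : AlgebraicClosure ℚ) ∧ c₀ • s = -s ∧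
      (∀ g ∈ Hm, g • s = s) ∧ (c ∈ Hm → ∃ y : ℝ, ι s = y ∧ y ≤ -1) := by
  by_cases hcH : c ∈ Hm
  · have hreal : starRingEnd ℂ (ι s₁) = ι s₁ := by rw [← hιc, hs₁H c hcH]
    obtain ⟨x, hx⟩ := Complex.conj_eq_iff_real.mp hreal
    have hx0 : x ≠ 0 := by
      rintro rfl
      exact hs₁0 (ι.injective (by rw [hx, map_zero, Complex.ofReal_zero]))
    have hxd : x ^ 2 = (d : ℝ) := by
      have h := congrArg ι hs₁d
      rw [map_pow, hx, map_intCast] at h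
      exact_mod_cast h
    have hx1 : 1 ≤ x ^ 2 := by
      have hd0 : (0 : ℝ) < d := by rw [← hxd]; positivity
      have hd1 : (1 : ℤ) ≤ d := by exact_mod_cast hd0
      rw [hxd]
      exact_mod_cast hd1
    by_cases hxpos : 0 < x
    · refine ⟨-s₁, neg_ne_zero.2 hs₁0, by rw [neg_sq, hs₁d], by rw [smul_neg, hs₁c],
        fun g hg => by rw [smul_neg, hs₁H g hg], fun _ => ⟨-x, ?_, by nlinarith⟩⟩
      rw [map_neg, hx, Complex.ofReal_neg]
    · exact ⟨s₁, hs₁0, hs₁d, hs₁c, hs₁H, fun _ => ⟨x, hx, by nlinarith⟩⟩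
  · exact ⟨s₁, hs₁0, hs₁d, hs₁c, hs₁H, fun h => absurd h hcH⟩

/-! ### `hAT` over `ℚ` -/

/-- **The twisting character of Serre's trick exists over `ℚ`** — the hypothesis `hAT` of
`FramedGaloisRep.exists_odd_artinLift_diagonal_of_isSolvable_two_of_exists_twistChar` for
`K = ℚ`, verbatim ("[ArtinTate, X Thm. 5]: a character `ξ` of `G_L` of order two or four,
nontrivial at each `σ_i`, trivial at each `σ'_i` and at every place above `2`").  For the open
index-two subgroup `Hm ≤ Γ_ℚ` (`= G_L`) and `c₀ ∉ Hm`: with `s`, `s² = d ∈ ℤ`, the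
anti-invariant generator of `L = ℚ̄^{Hm}` (sign chosen at the real place), `N = N(v) ∈ v`,
`α = 1 + 4 N s` and `β² = α`, the function `ξ(g) = [g β = β] ? 1 : -1 ∈ ℤ̄₂` is multiplicative on
`Hm`, of order `2`, `≡ 1 (mod 𝔪)`, trivial on an open normal subgroup inside `Hm`, satisfies
`ξ(c) ξ(c₀⁻¹ c c₀) = -1` at a complex conjugation `c ∈ Hm` (`ι α < 0 < ι ᾱ`), and is trivial on
`Γ_{ℚ_v} ∩ Hm` and `c₀⁻¹ Γ_{ℚ_v} c₀ ∩ Hm` (`absGaloisRestrict_smul_eq_self_of_sq_eq_one_add`).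
[cite: Allen2014, Lemma 87 (arXiv:1301.1113, §5.1.1, p. 70)] -/
theorem exists_twistChar_rat (v : HeightOneSpectrum (𝓞 ℚ)) (Hm : Subgroup (absoluteGaloisGroup ℚ))
    (c₀ : absoluteGaloisGroup ℚ) (hopen : IsOpen (Hm : Set (absoluteGaloisGroup ℚ)))
    (hc₀ : c₀ ∉ Hm) (h2 : ∀ g g', g ∉ Hm → g' ∉ Hm → g * g' ∈ Hm) :
    ∃ (ξ : absoluteGaloisGroup ℚ → padicAlgClIntegers 2) (m : ℕ), 0 < m ∧
      (∀ x ∈ Hm, ∀ y ∈ Hm, ξ (x * y) = ξ x * ξ y) ∧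
      (∀ x ∈ Hm, (ξ x : PadicAlgCl 2) ^ m = 1) ∧
      (∀ x ∈ Hm, residue (padicAlgClIntegers 2) (ξ x) = 1) ∧
      (∃ N : Subgroup (absoluteGaloisGroup ℚ), N.Normal ∧
        IsOpen (N : Set (absoluteGaloisGroup ℚ)) ∧ ∀ g ∈ N, g ∈ Hm ∧ ξ g = 1) ∧
      (∀ φ : ℚ →+* ℝ, ∃ c : absoluteGaloisGroup ℚ, IsComplexConjugation φ c ∧
        (c ∈ Hm → (ξ c : PadicAlgCl 2) * (ξ (c₀⁻¹ * c * c₀) : PadicAlgCl 2) = -1)) ∧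
      (∀ σ, absGaloisRestrict ℚ (v.adicCompletion ℚ) σ ∈ Hm →
        ξ (absGaloisRestrict ℚ (v.adicCompletion ℚ) σ) = 1) ∧
      (∀ σ, c₀⁻¹ * absGaloisRestrict ℚ (v.adicCompletion ℚ) σ * c₀ ∈ Hm →
        ξ (c₀⁻¹ * absGaloisRestrict ℚ (v.adicCompletion ℚ) σ * c₀) = 1) := by
  classical
  -- the quadratic datum, with the sign fixed at the real place
  obtain ⟨s₁, d, hs₁0, hs₁d, hs₁c, hs₁H⟩ :=
    exists_smul_eq_neg_of_forall_mul_mem_rat Hm c₀ hopen hc₀ h2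
  obtain ⟨cst, hcst⟩ := exists_isComplexConjugation (Rat.castHom ℝ)
  obtain ⟨ι, -, hιc⟩ := isComplexConjugation_iff.mp hcst
  obtain ⟨s, hs0, hsd, hsc, hsH, hsneg⟩ :=
    exists_generator_ofReal_le_neg_one hs₁0 hs₁d hs₁c hs₁H (c := cst) (ι := ι) hιc
  -- `N = N(v) ∈ v`
  set N : ℕ := Ideal.absNorm v.asIdeal with hNdef
  have hNmem : (N : 𝓞 ℚ) ∈ v.asIdeal := Ideal.absNorm_mem v.asIdeal
  have hN1 : 1 < N := NumberField.HeightOneSpectrum.one_lt_absNorm v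
  -- `α = 1 + 4 N s`, `β² = α`
  obtain ⟨β, hβ⟩ := IsAlgClosed.exists_pow_nat_eq (1 + 4 * (N : AlgebraicClosure ℚ) * s) two_pos
  have hact : ∀ (g : absoluteGaloisGroup ℚ) (x : AlgebraicClosure ℚ),
      g • (1 + 4 * (N : AlgebraicClosure ℚ) * x) = 1 + 4 * (N : AlgebraicClosure ℚ) * g • x := by
    intro g x
    simp only [absoluteGaloisGroup.smul_def, map_add, map_one, map_mul, map_natCast, map_ofNat]
  have hβH : ∀ g ∈ Hm, g • β = β ∨ g • β = -β := by
    intro g hg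
    apply sq_eq_sq_iff_eq_or_eq_neg.1
    rw [← smul_pow', hβ, hact, hsH g hg]
  have hα0 : (1 + 4 * (N : AlgebraicClosure ℚ) * s) ≠ 0 := by
    intro h
    have h1 : c₀ • (1 + 4 * (N : AlgebraicClosure ℚ) * s) = 0 := by rw [h, smul_zero]
    rw [hact, hsc] at h1
    have h8 : (8 * (N : AlgebraicClosure ℚ)) * s = 0 := by linear_combination h - h1
    rcases mul_eq_zero.1 h8 with h8 | h8
    · have hN0 : (N : AlgebraicClosure ℚ) ≠ 0 := Nat.cast_ne_zero.2 (by omega)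
      exact (mul_ne_zero (by norm_num) hN0) h8
    · exact hs0 h8
  have hβ0 : β ≠ 0 := by
    rintro rfl
    exact hα0 (by rw [← hβ]; ring)
  have hβneg : -β ≠ β := fun h => hβ0 (by
    have h2β : (2 : AlgebraicClosure ℚ) * β = 0 := by linear_combination -h
    simpa using h2β)
  -- the character
  set ξ : absoluteGaloisGroup ℚ → padicAlgClIntegers 2 := fun g => if g • β = β then 1 else -1
    with hξ
  have hξ1 : ∀ g, g • β = β → ξ g = 1 := fun g h => if_pos h
  have hξ2 : ∀ g, g • β = -β → ξ g = -1 := fun g h => if_neg (by rw [h]; exact hβneg)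
  have hres1 : residue (padicAlgClIntegers 2) (-1) = 1 := by
    rw [map_neg, map_one, neg_eq_iff_add_eq_zero, one_add_one_eq_two]
    exact two_eq_zero_padicAlgClResidueField_two
  refine ⟨ξ, 2, two_pos, ?_, ?_, ?_, ?_, ?_, ?_, ?_⟩
  · -- multiplicative on `Hm`
    intro x hx y hy
    rcases hβH y hy with hy' | hy'
    · have hxy : (x * y) • β = x • β := by rw [mul_smul, hy']
      rcases hβH x hx with hx' | hx'
      · rw [hξ1 _ (hxy.trans hx'), hξ1 _ hx', hξ1 _ hy', mul_one]
      · rw [hξ2 _ (hxy.trans hx'), hξ2 _ hx', hξ1 _ hy', mul_one]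
    · have hxy : (x * y) • β = -(x • β) := by rw [mul_smul, hy', smul_neg]
      rcases hβH x hx with hx' | hx'
      · rw [hx'] at hxy
        rw [hξ2 _ hxy, hξ1 _ hx', hξ2 _ hy', one_mul]
      · rw [hx', neg_neg] at hxy
        rw [hξ1 _ hxy, hξ2 _ hx', hξ2 _ hy', neg_mul_neg, one_mul]
  · -- order two
    intro x hx
    rcases hβH x hx with h | h
    · rw [hξ1 _ h, OneMemClass.coe_one, one_pow]
    · rw [hξ2 _ h, NegMemClass.coe_neg, OneMemClass.coe_one, neg_one_sq]
  · -- trivial modulo `𝔪`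
    intro x hx
    rcases hβH x hx with h | h
    · rw [hξ1 _ h, map_one]
    · rw [hξ2 _ h, hres1]
  · -- open normal subgroup
    obtain ⟨N', hN'n, hN'o, hN'⟩ := exists_normal_isOpen_forall_smul_eq Hm hopen β
    exact ⟨N', hN'n, hN'o, fun g hg => ⟨(hN' g hg).1, hξ1 g (hN' g hg).2⟩⟩
  · -- the real place
    intro φ
    obtain rfl : φ = Rat.castHom ℝ := Subsingleton.elim _ _
    refine ⟨cst, hcst, fun hcH => ?_⟩
    obtain ⟨y, hy, hy1⟩ := hsneg hcH
    have hN1' : (1 : ℝ) ≤ N := by exact_mod_cast hN1.le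
    -- `ξ c = -1`
    have hc1 : cst • β = -β := by
      rcases hβH cst hcH with h | h
      · exfalso
        have hreal : starRingEnd ℂ (ι β) = ι β := by rw [← hιc, h]
        have him : (ι β).im = 0 := Complex.conj_eq_iff_im.1 hreal
        have hre : 0 ≤ ((ι β) ^ 2).re := by
          rw [pow_two, Complex.mul_re, him, mul_zero, sub_zero]
          exact mul_self_nonneg _
        have e : ((ι β) ^ 2).re = 1 + 4 * N * y := by
          rw [← map_pow, hβ, map_add, map_one, map_mul, map_mul, map_ofNat, map_natCast, hy]
          have e' : (1 + 4 * (N : ℂ) * (y : ℂ)) = ((1 + 4 * (N : ℝ) * y : ℝ) : ℂ) := by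
            push_cast; ring
          rw [e', Complex.ofReal_re]
        rw [e] at hre
        nlinarith
      · exact h
    -- `ξ (c₀⁻¹ c c₀) = 1`
    have hc2 : (c₀⁻¹ * cst * c₀) • β = β := by
      rw [mul_smul, mul_smul, inv_smul_eq_iff]
      have hβ' : (c₀ • β) ^ 2 = 1 + 4 * (N : AlgebraicClosure ℚ) * (-s) := by
        rw [← smul_pow', hβ, hact, hsc]
      have hsq : (ι (c₀ • β)) ^ 2 = ((1 - 4 * (N : ℝ) * y : ℝ) : ℂ) := by
        rw [← map_pow, hβ', map_add, map_one, map_mul, map_mul, map_ofNat, map_natCast, map_neg,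
          hy]
        push_cast
        ring
      have hpos : 0 < 1 - 4 * (N : ℝ) * y := by nlinarith
      have hreal := complex_conj_eq_self_of_sq_eq_ofReal hpos hsq
      apply ι.injective
      rw [hιc, hreal]
    rw [hξ2 _ hc1, hξ1 _ hc2, NegMemClass.coe_neg, OneMemClass.coe_one, neg_one_mul]
  · -- trivial on `Γ_{ℚ_v} ∩ Hm`
    intro σ hσ
    apply hξ1
    exact absGaloisRestrict_smul_eq_self_of_sq_eq_one_add v hNmem hsd hβ σ (hsH _ hσ)
  · -- trivial on `c₀⁻¹ Γ_{ℚ_v} c₀ ∩ Hm`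
    intro σ hσ
    apply hξ1
    rw [mul_smul, mul_smul, inv_smul_eq_iff]
    have hgs : absGaloisRestrict ℚ (v.adicCompletion ℚ) σ • s = s := by
      have h := hsH _ hσ
      rw [mul_smul, mul_smul, inv_smul_eq_iff, hsc, smul_neg, neg_inj] at h
      exact h
    have hβ' : (c₀ • β) ^ 2 = 1 + 4 * (N : AlgebraicClosure ℚ) * (-s) := by
      rw [← smul_pow', hβ, hact, hsc]
    have hnegs : (-s) ^ 2 = (d : AlgebraicClosure ℚ) := by rw [neg_sq, hsd]
    exact absGaloisRestrict_smul_eq_self_of_sq_eq_one_add v hNmem hnegs hβ' σ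
      (by rw [smul_neg, hgs])

/-! ### Allen's Lemma 87, Galois side, over `ℚ` — unconditionally -/

/-- **Allen 2014, Lemma 87 (OrdinaryLift), the Galois side at `p = 2` over `ℚ`: an ODD Artin
lift of `ρ̄` split on the decomposition group — no hypotheses beyond (4) and a triangular form
at `v`.**  For `ρ : Γ_ℚ → GL₂(ℚ̄₂)` residually absolutely irreducible with solvable residual image
and `Q (ρ̄|_{Γ_{ℚ_v}}) Q⁻¹ = (χ̄'_v ∗ ; 0 χ̄_v)`, there is a continuous ODD `ρ₁ : Γ_ℚ → GL₂(ℚ̄₂)`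
with integral model, open kernel, entries `0` or roots of unity, of which `ρ̄ = ρ.residualRep` is
a reduction, and `P⁻¹ ρ₁|_{Γ_{ℚ_v}} P = diag(χ'_v, χ_v)` with `χ'_v, χ_v : Γ_{ℚ_v} → ℤ̄₂`
continuous of finite order lifting `χ̄'_v, χ̄_v` — the theorem
`FramedGaloisRep.exists_odd_artinLift_diagonal_of_isSolvable_two_of_exists_twistChar` with its
hypothesis `hAT` discharged by `exists_twistChar_rat` ("the lift `ρ₁` is totally odd …
`ρ₁|_{G_v} ≅ (χ'_v 0 ; 0 χ_v)`").
[cite: Allen2014, Lemma 87 and the preceding paragraph (arXiv:1301.1113, §5.1.1, pp. 69–70)] -/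
theorem FramedGaloisRep.exists_odd_artinLift_diagonal_of_isSolvable_two_rat
    (ρ : FramedGaloisRep ℚ (PadicAlgCl 2) 2) (hres : ρ.IsResiduallyAbsIrreducible)
    (hsol : IsSolvable ρ.residualRep.range) (v : HeightOneSpectrum (𝓞 ℚ))
    (Qv : GL (Fin 2) (padicAlgClResidueField 2))
    (hQv : ∀ σ, (conjGL Qv (ρ.residualRep.comp
      (absGaloisRestrict ℚ (v.adicCompletion ℚ)).toMonoidHom) σ).val 1 0 = 0) :
    ∃ (ρ₁ : FramedGaloisRep ℚ (PadicAlgCl 2) 2)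
      (ρ₀' : absoluteGaloisGroup ℚ →* GL (Fin 2) (padicAlgClIntegers 2)) (N : ℕ), 0 < N ∧
      (∀ σ, Matrix.GeneralLinearGroup.map (padicAlgClIntegers 2).subtype (ρ₀' σ) = ρ₁ σ) ∧
      IsOpen ((ρ₁ : absoluteGaloisGroup ℚ →* GL (Fin 2) (PadicAlgCl 2)).ker :
        Set (absoluteGaloisGroup ℚ)) ∧
      ρ₁.IsReductionOf (RingHom.id _) ρ.residualRep ∧
      (∀ σ i j, (ρ₀' σ).val i j = 0 ∨ ((ρ₀' σ).val i j : PadicAlgCl 2) ^ N = 1) ∧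
      ρ₁.IsOdd ∧
      ∃ (P : GL (Fin 2) (PadicAlgCl 2))
        (χ₁ χ₂ : absoluteGaloisGroup (v.adicCompletion ℚ) →* padicAlgClIntegers 2),
        (∀ σ, (P⁻¹ * ρ₁.toLocal v σ * P).val =
          Matrix.diagonal ![(χ₁ σ : PadicAlgCl 2), (χ₂ σ : PadicAlgCl 2)]) ∧
        (∀ σ, (χ₁ σ : PadicAlgCl 2) ^ (2 * N) = 1 ∧ (χ₂ σ : PadicAlgCl 2) ^ (2 * N) = 1) ∧
        (∀ σ, residue (padicAlgClIntegers 2) (χ₁ σ) =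
            (conjGL Qv (ρ.residualRep.comp
              (absGaloisRestrict ℚ (v.adicCompletion ℚ)).toMonoidHom) σ).val 0 0 ∧
          residue (padicAlgClIntegers 2) (χ₂ σ) =
            (conjGL Qv (ρ.residualRep.comp
              (absGaloisRestrict ℚ (v.adicCompletion ℚ)).toMonoidHom) σ).val 1 1) ∧
        Continuous (fun σ => (χ₁ σ : PadicAlgCl 2)) ∧
        Continuous (fun σ => (χ₂ σ : PadicAlgCl 2)) :=
  ρ.exists_odd_artinLift_diagonal_of_isSolvable_two_of_exists_twistChar hres hsol v Qv hQv
    (fun Hm c₀ hopen' hc₀ h2 => exists_twistChar_rat v Hm c₀ hopen' hc₀ h2)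

/-- **Allen 2014, Lemma 87 at `p = 2` over `ℚ`, from hypotheses (2) and (4) of the Introduction
Theorem, unconditionally** ("for each `v ∣ p`, `ρ̄|_{G_v}` is reducible. Write
`ρ̄|_{G_v} ≅ (χ̄'_v ∗ ; 0 χ̄_v)` … the lift `ρ₁` is totally odd … `ρ₁|_{G_v} ≅ (χ'_v 0 ; 0 χ_v)`",
pp. 69–70): for `ρ : Γ_ℚ → GL₂(ℚ̄₂)` residually absolutely irreducible with solvable residual
image and ordinary of some weight at the finite place `v` (so `ρ̄|_{Γ_{ℚ_v}}` is reducible,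
`FramedGaloisRep.IsOrdinaryOfWeightAt.hasCommonEigenvector_residualRep_comp`), there are a
triangular form `Q (ρ̄|_{Γ_{ℚ_v}}) Q⁻¹ = (χ̄'_v ∗ ; 0 χ̄_v)` and an ODD continuous Artin lift `ρ₁`
of `ρ̄` with integral model, open kernel, root-of-unity entries and
`ρ₁|_{Γ_{ℚ_v}} ≅ χ'_v ⊕ χ_v`, `χ'_v ≡ χ̄'_v`, `χ_v ≡ χ̄_v (mod 𝔪)`.
[cite: Allen2014, Lemma 87 and the preceding paragraph (arXiv:1301.1113, §5.1.1, pp. 69–70)] -/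
theorem FramedGaloisRep.exists_odd_artinLift_diagonal_of_isOrdinaryOfWeightAt_two_rat
    (ρ : FramedGaloisRep ℚ (PadicAlgCl 2) 2) (hres : ρ.IsResiduallyAbsIrreducible)
    (hsol : IsSolvable ρ.residualRep.range) (v : HeightOneSpectrum (𝓞 ℚ)) {k m : ℕ}
    (hord : FramedGaloisRep.IsOrdinaryOfWeightAt 2 ρ v k m) :
    ∃ (ρ₁ : FramedGaloisRep ℚ (PadicAlgCl 2) 2)
      (ρ₀' : absoluteGaloisGroup ℚ →* GL (Fin 2) (padicAlgClIntegers 2)) (N : ℕ), 0 < N ∧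
      (∀ σ, Matrix.GeneralLinearGroup.map (padicAlgClIntegers 2).subtype (ρ₀' σ) = ρ₁ σ) ∧
      IsOpen ((ρ₁ : absoluteGaloisGroup ℚ →* GL (Fin 2) (PadicAlgCl 2)).ker :
        Set (absoluteGaloisGroup ℚ)) ∧
      ρ₁.IsReductionOf (RingHom.id _) ρ.residualRep ∧
      (∀ σ i j, (ρ₀' σ).val i j = 0 ∨ ((ρ₀' σ).val i j : PadicAlgCl 2) ^ N = 1) ∧
      ρ₁.IsOdd ∧
      ∃ (Q : GL (Fin 2) (padicAlgClResidueField 2)) (P : GL (Fin 2) (PadicAlgCl 2))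
        (χ₁ χ₂ : absoluteGaloisGroup (v.adicCompletion ℚ) →* padicAlgClIntegers 2),
        (∀ σ, (conjGL Q (ρ.residualRep.comp
          (absGaloisRestrict ℚ (v.adicCompletion ℚ)).toMonoidHom) σ).val 1 0 = 0) ∧
        (∀ σ, (P⁻¹ * ρ₁.toLocal v σ * P).val =
          Matrix.diagonal ![(χ₁ σ : PadicAlgCl 2), (χ₂ σ : PadicAlgCl 2)]) ∧
        (∀ σ, (χ₁ σ : PadicAlgCl 2) ^ (2 * N) = 1 ∧ (χ₂ σ : PadicAlgCl 2) ^ (2 * N) = 1) ∧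
        (∀ σ, residue (padicAlgClIntegers 2) (χ₁ σ) =
            (conjGL Q (ρ.residualRep.comp
              (absGaloisRestrict ℚ (v.adicCompletion ℚ)).toMonoidHom) σ).val 0 0 ∧
          residue (padicAlgClIntegers 2) (χ₂ σ) =
            (conjGL Q (ρ.residualRep.comp
              (absGaloisRestrict ℚ (v.adicCompletion ℚ)).toMonoidHom) σ).val 1 1) ∧
        Continuous (fun σ => (χ₁ σ : PadicAlgCl 2)) ∧
        Continuous (fun σ => (χ₂ σ : PadicAlgCl 2)) := by
  obtain ⟨R, hR⟩ :=
    hord.hasCommonEigenvector_residualRep_comp.exists_conjGL_apply_one_zero_eq_zero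
  obtain ⟨ρ₁, ρ₀', N, hN, hmap, hopen, hred, hroots, hodd, P, χ₁, χ₂, h1, h2, h3, h4, h5⟩ :=
    ρ.exists_odd_artinLift_diagonal_of_isSolvable_two_rat hres hsol v R⁻¹ hR
  exact ⟨ρ₁, ρ₀', N, hN, hmap, hopen, hred, hroots, hodd, R⁻¹, P, χ₁, χ₂, hR, h1, h2, h3, h4, h5⟩

end Rat

/-! ### The induced structure of the odd lift, exported -/

section Monomial

variable {K : Type*} [Field K] [NumberField K]

/-- **Allen's Lemma 87, Galois side at `p = 2`, modulo `hAT` — with the INDUCED structure of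
`ρ₁ = Ind_{G_L}^{G_K} (χ ξ)` exported.**  Same statement and proof as
`FramedGaloisRep.exists_odd_artinLift_diagonal_of_isSolvable_two_of_exists_twistChar`
(`SerreTrickArtinLift`), recording in addition the open index-two subgroup `Hm = G_L ≤ Γ_K`
(`L` the quadratic field cut out by the dihedral `ρ̄`, `ker ρ̄ ≤ Hm`) with respect to which
the integral model `ρ₀'` of `ρ₁` is MONOMIAL — diagonal on `Hm`, antidiagonal off `Hm` — i.e.
`ρ₁ ≅ Ind_{G_L}^{G_K} ψ` for the character `ψ = (ρ₀')₀₀|_{Hm}` ("we set `ρ₁ = Ind χ ξ`"), the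
shape under which the weight-one form of `ρ₁` is a theta series of `L` ("a classical
construction yields a cuspidal Hilbert modular newform `f₁` of weight `((1,…,1),(0,…,0))` such
that `ρ_{f₁} ≅ ρ₁`").
[cite: Allen2014, Lemma 87 (arXiv:1301.1113, §5.1.1, pp. 69–70)] -/
theorem FramedGaloisRep.exists_odd_monomial_artinLift_diagonal_of_isSolvable_two_of_exists_twistChar
    (ρ : FramedGaloisRep K (PadicAlgCl 2) 2) (hres : ρ.IsResiduallyAbsIrreducible)
    (hsol : IsSolvable ρ.residualRep.range) (v : HeightOneSpectrum (𝓞 K))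
    (Qv : GL (Fin 2) (padicAlgClResidueField 2))
    (hQv : ∀ σ, (conjGL Qv (ρ.residualRep.comp
      (absGaloisRestrict K (v.adicCompletion K)).toMonoidHom) σ).val 1 0 = 0)
    (hAT : ∀ (Hm : Subgroup (absoluteGaloisGroup K)) (c₀ : absoluteGaloisGroup K),
      IsOpen (Hm : Set (absoluteGaloisGroup K)) → c₀ ∉ Hm →
      (∀ g g', g ∉ Hm → g' ∉ Hm → g * g' ∈ Hm) →
      ∃ (ξ : absoluteGaloisGroup K → padicAlgClIntegers 2) (m : ℕ), 0 < m ∧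
        (∀ x ∈ Hm, ∀ y ∈ Hm, ξ (x * y) = ξ x * ξ y) ∧
        (∀ x ∈ Hm, (ξ x : PadicAlgCl 2) ^ m = 1) ∧
        (∀ x ∈ Hm, residue (padicAlgClIntegers 2) (ξ x) = 1) ∧
        (∃ N : Subgroup (absoluteGaloisGroup K), N.Normal ∧
          IsOpen (N : Set (absoluteGaloisGroup K)) ∧ ∀ g ∈ N, g ∈ Hm ∧ ξ g = 1) ∧
        (∀ φ : K →+* ℝ, ∃ c : absoluteGaloisGroup K, IsComplexConjugation φ c ∧
          (c ∈ Hm → (ξ c : PadicAlgCl 2) * (ξ (c₀⁻¹ * c * c₀) : PadicAlgCl 2) = -1)) ∧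
        (∀ σ, absGaloisRestrict K (v.adicCompletion K) σ ∈ Hm →
          ξ (absGaloisRestrict K (v.adicCompletion K) σ) = 1) ∧
        (∀ σ, c₀⁻¹ * absGaloisRestrict K (v.adicCompletion K) σ * c₀ ∈ Hm →
          ξ (c₀⁻¹ * absGaloisRestrict K (v.adicCompletion K) σ * c₀) = 1)) :
    ∃ (ρ₁ : FramedGaloisRep K (PadicAlgCl 2) 2)
      (ρ₀' : absoluteGaloisGroup K →* GL (Fin 2) (padicAlgClIntegers 2))
      (Hm : Subgroup (absoluteGaloisGroup K)) (N : ℕ), 0 < N ∧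
      (∀ σ, Matrix.GeneralLinearGroup.map (padicAlgClIntegers 2).subtype (ρ₀' σ) = ρ₁ σ) ∧
      IsOpen ((ρ₁ : absoluteGaloisGroup K →* GL (Fin 2) (PadicAlgCl 2)).ker :
        Set (absoluteGaloisGroup K)) ∧
      ρ₁.IsReductionOf (RingHom.id _) ρ.residualRep ∧
      (∀ σ i j, (ρ₀' σ).val i j = 0 ∨ ((ρ₀' σ).val i j : PadicAlgCl 2) ^ N = 1) ∧
      ρ₁.IsOdd ∧
      IsOpen (Hm : Set (absoluteGaloisGroup K)) ∧ Hm.index = 2 ∧ ρ.residualRep.ker ≤ Hm ∧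
      (∀ h ∈ Hm, (ρ₀' h).val 0 1 = 0 ∧ (ρ₀' h).val 1 0 = 0) ∧
      (∀ g ∉ Hm, (ρ₀' g).val 0 0 = 0 ∧ (ρ₀' g).val 1 1 = 0) ∧
      ∃ (P : GL (Fin 2) (PadicAlgCl 2))
        (χ₁ χ₂ : absoluteGaloisGroup (v.adicCompletion K) →* padicAlgClIntegers 2),
        (∀ σ, (P⁻¹ * ρ₁.toLocal v σ * P).val =
          Matrix.diagonal ![(χ₁ σ : PadicAlgCl 2), (χ₂ σ : PadicAlgCl 2)]) ∧
        (∀ σ, (χ₁ σ : PadicAlgCl 2) ^ (2 * N) = 1 ∧ (χ₂ σ : PadicAlgCl 2) ^ (2 * N) = 1) ∧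
        (∀ σ, residue (padicAlgClIntegers 2) (χ₁ σ) =
            (conjGL Qv (ρ.residualRep.comp
              (absGaloisRestrict K (v.adicCompletion K)).toMonoidHom) σ).val 0 0 ∧
          residue (padicAlgClIntegers 2) (χ₂ σ) =
            (conjGL Qv (ρ.residualRep.comp
              (absGaloisRestrict K (v.adicCompletion K)).toMonoidHom) σ).val 1 1) ∧
        Continuous (fun σ => (χ₁ σ : PadicAlgCl 2)) ∧
        Continuous (fun σ => (χ₂ σ : PadicAlgCl 2)) := by
  obtain ⟨hspec, hfin, hce, hdih⟩ := ρ.isDihedralType_residualRep_of_isSolvable_two hres hsol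
  haveI := hfin
  obtain ⟨ρ₀, Q, n, Hm, c₁, hn0, hn, hker, hQ, hroots, hshape, hc₁, h2, hkerle, hmem, hdg, had⟩ :=
    exists_teichmullerLift_of_isDihedralType_subgroup ρ.residualRep hce hdih
  -- the coset representative: in the decomposition group at `v` if possible
  obtain ⟨c₀, hc₀, hsplit⟩ : ∃ c₀, c₀ ∉ Hm ∧
      ((∀ σ, absGaloisRestrict K (v.adicCompletion K) σ ∈ Hm) ∨
        ∃ σ₀, absGaloisRestrict K (v.adicCompletion K) σ₀ = c₀) := by
    by_cases hall : ∀ σ, absGaloisRestrict K (v.adicCompletion K) σ ∈ Hm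
    · exact ⟨c₁, hc₁, Or.inl hall⟩
    · push Not at hall
      obtain ⟨σ₀, hσ₀⟩ := hall
      exact ⟨_, hσ₀, Or.inr ⟨σ₀, rfl⟩⟩
  -- `Hm` is open (it contains the open kernel of `ρ̄`)
  have hopenker : IsOpen (ρ.residualRep.ker : Set (absoluteGaloisGroup K)) :=
    FramedGaloisRep.isOpen_ker_of_isResidualRepOf hspec
  have hHmopen : IsOpen (Hm : Set (absoluteGaloisGroup K)) := Subgroup.isOpen_mono hkerle hopenker
  have hopen0 : IsOpen (ρ₀.ker : Set (absoluteGaloisGroup K)) := by rwa [hker]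
  -- the twisting character and the twist
  obtain ⟨ξ, m, hm0, hξ, hξm, hξres, hξN, hξodd, hξf, hξf'⟩ := hAT Hm c₀ hHmopen hc₀ h2
  obtain ⟨ρ', ρ₁, hmap, hopen, hρ, hρ', hredeq, hroots', hdet, hloc⟩ :=
    FramedGaloisRep.exists_twist_artinLift ρ₀ hopen0 Hm c₀ hc₀ h2 hdg had hm0 hroots ξ hξ hξm
      hξres hξN
  -- the exported structure: index two, monomial shape of the twist
  have hindex : Hm.index = 2 := by
    rw [Subgroup.index_eq_two_iff]
    refine ⟨c₀, fun b => ?_⟩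
    by_cases hb : b ∈ Hm
    · exact Or.inr ⟨hb, fun h => hc₀ (by simpa using Hm.mul_mem (Hm.inv_mem hb) h)⟩
    · exact Or.inl ⟨h2 _ _ hb hc₀, hb⟩
  have hdg' : ∀ h ∈ Hm, (ρ' h).val 0 1 = 0 ∧ (ρ' h).val 1 0 = 0 := fun h hh => by
    obtain ⟨h01, h10⟩ := hdg h hh
    simp only [hρ h hh, Matrix.diagonal_mul, h01, h10, mul_zero, and_self]
  have had' : ∀ g ∉ Hm, (ρ' g).val 0 0 = 0 ∧ (ρ' g).val 1 1 = 0 := fun g hg => by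
    obtain ⟨h00, h11⟩ := had g hg
    simp only [hρ' g hg, Matrix.diagonal_mul, h00, h11, mul_zero, and_self]
  have hred1 : ρ₁.IsReductionOf (RingHom.id _) ρ.residualRep :=
    ⟨ρ', Q, ⟨1, fun σ => by rw [inv_one, one_mul, mul_one]; exact hmap σ⟩,
      fun g => by rw [hredeq]; exact hQ g⟩
  have hNpos : 0 < n * m := Nat.mul_pos hn0 hm0
  -- oddness
  have hodd : ρ₁.IsOdd := by
    intro φ c' hcc'
    -- reduce to the complex conjugation `c` for `φ` provided by `hAT` (all are conjugate)
    obtain ⟨c, hcc, hcodd⟩ := hξodd φ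
    obtain ⟨γ, hγ⟩ := isConj_iff.mp (hcc.isConj hcc')
    rw [← hγ, map_mul, map_mul, map_inv, map_mul, map_mul, map_inv,
      mul_comm (Matrix.GeneralLinearGroup.det (ρ₁ γ)) (Matrix.GeneralLinearGroup.det (ρ₁ c)),
      mul_inv_cancel_right]
    by_cases hc : c ∈ Hm
    · -- `c ∈ G_L`: `ρ₀(c) = 1`, and `det ρ₁(c) = ξ(c) ξ(c₀⁻¹ c c₀) = -1`
      have hc2 : ρ₀ c * ρ₀ c = 1 := by rw [← map_mul, ← sq, hcc.sq_eq_one, map_one]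
      obtain ⟨h01, h10⟩ := hdg c hc
      have hdetO : (ρ₀ c).val 0 0 * (ρ₀ c).val 1 1 ≠ 0 := by
        intro h0
        have hu := (ρ₀ c).isUnit.map Matrix.detMonoidHom
        rw [Matrix.coe_detMonoidHom, Matrix.det_fin_two, h01, zero_mul, sub_zero, h0] at hu
        exact not_isUnit_zero hu
      have hsq0 : ((ρ₀ c).val 0 0 : PadicAlgCl 2) ^ 2 = 1 := by
        have e := congrArg (fun M : GL (Fin 2) (padicAlgClIntegers 2) =>
          (M.val 0 0 : PadicAlgCl 2)) hc2
        simp only [Units.val_mul, Units.val_one, Matrix.mul_apply, Fin.sum_univ_two, h01,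
          zero_mul, add_zero, Matrix.one_apply_eq, OneMemClass.coe_one, MulMemClass.coe_mul] at e
        rw [pow_two]
        exact e
      have hsq1 : ((ρ₀ c).val 1 1 : PadicAlgCl 2) ^ 2 = 1 := by
        have e := congrArg (fun M : GL (Fin 2) (padicAlgClIntegers 2) =>
          (M.val 1 1 : PadicAlgCl 2)) hc2
        simp only [Units.val_mul, Units.val_one, Matrix.mul_apply, Fin.sum_univ_two, h10,
          zero_mul, zero_add, Matrix.one_apply_eq, OneMemClass.coe_one, MulMemClass.coe_mul] at e
        rw [pow_two]
        exact e
      have hg2 : n.gcd 2 = 1 := ((Nat.Prime.coprime_iff_not_dvd Nat.prime_two).2 hn).symm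
      have hone0 : ((ρ₀ c).val 0 0 : PadicAlgCl 2) = 1 := by
        have hni : ((ρ₀ c).val 0 0 : PadicAlgCl 2) ^ n = 1 :=
          (hroots c 0 0).resolve_left fun h0 => hdetO (by rw [h0, zero_mul])
        have h := (pow_gcd_eq_one (m := n) (n := 2)).mpr ⟨hni, hsq0⟩
        rwa [hg2, pow_one] at h
      have hone1 : ((ρ₀ c).val 1 1 : PadicAlgCl 2) = 1 := by
        have hni : ((ρ₀ c).val 1 1 : PadicAlgCl 2) ^ n = 1 :=
          (hroots c 1 1).resolve_left fun h0 => hdetO (by rw [h0, mul_zero])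
        have h := (pow_gcd_eq_one (m := n) (n := 2)).mpr ⟨hni, hsq1⟩
        rwa [hg2, pow_one] at h
      have hdet1 : (((ρ₀ c).val.det : padicAlgClIntegers 2) : PadicAlgCl 2) = 1 := by
        rw [Matrix.det_fin_two, h01, zero_mul, sub_zero, MulMemClass.coe_mul, hone0, hone1,
          mul_one]
      refine Units.ext ?_
      rw [hdet c hc, hdet1, mul_one, hcodd hc, Units.val_neg, Units.val_one]
    · -- `c ∉ G_L`: `ρ̄(c) ≠ 1` and the involution argument
      refine ρ₁.det_eq_neg_one_of_isReductionOf_ne_one_two hred1 hcc fun h1 => ?_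
      have had' : GL2.IsAd (integralReduction (RingHom.id _) ρ₀ c).val :=
        (hshape c).resolve_left ((hmem c).not.1 hc)
      have e : integralReduction (RingHom.id _) ρ₀ c = 1 := by
        have h := hQ c
        rw [h1] at h
        -- `1 = Q * red c * Q⁻¹`
        calc integralReduction (RingHom.id _) ρ₀ c
            = Q⁻¹ * (Q * integralReduction (RingHom.id _) ρ₀ c * Q⁻¹) * Q := by group
          _ = 1 := by rw [← h, mul_one, inv_mul_cancel]
      have h00 := had'.1
      rw [e, Units.val_one, Matrix.one_apply_eq] at h00
      exact one_ne_zero h00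
  -- the local shape: the twist agrees with `ρ₀` on `Γ_{K_v}`, where Theorem A applies
  have hcomp := hloc v hξf hξf' hsplit
  have hconj : ∀ σ,
      conjGL (Qv * Q) ((integralReduction (RingHom.id _) ρ₀).comp
        (absGaloisRestrict K (v.adicCompletion K)).toMonoidHom) σ =
      conjGL Qv (ρ.residualRep.comp (absGaloisRestrict K (v.adicCompletion K)).toMonoidHom) σ := by
    intro σ
    rw [conjGL_apply, conjGL_apply, MonoidHom.comp_apply, MonoidHom.comp_apply, hQ]
    group
  have hQ' : ∀ σ, (conjGL (Qv * Q) ((integralReduction (RingHom.id _) ρ₀).comp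
      (absGaloisRestrict K (v.adicCompletion K)).toMonoidHom) σ).val 1 0 = 0 := fun σ => by
    rw [hconj σ]
    exact hQv σ
  obtain ⟨P, χ₁, χ₂, hdiag, hpow, hresid⟩ := exists_conjGL_diagonal_comp_of_monomial hn0 hn ρ₀
    hroots hshape (absGaloisRestrict K (v.adicCompletion K)).toMonoidHom (Qv * Q) hQ'
  have hloc₁ : ∀ σ, ρ₁.toLocal v σ =
      Matrix.GeneralLinearGroup.map (padicAlgClIntegers 2).subtype
        (ρ₀ ((absGaloisRestrict K (v.adicCompletion K)).toMonoidHom σ)) := by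
    intro σ
    rw [FramedGaloisRep.toLocal_apply, ← hmap]
    have e := congrArg (fun ψ : absoluteGaloisGroup (v.adicCompletion K) →*
      GL (Fin 2) (padicAlgClIntegers 2) => ψ σ) hcomp
    simp only [MonoidHom.comp_apply] at e
    rw [← e]
    rfl
  have hdiag' : ∀ σ, (P⁻¹ * ρ₁.toLocal v σ * P).val =
      Matrix.diagonal ![(χ₁ σ : PadicAlgCl 2), (χ₂ σ : PadicAlgCl 2)] := fun σ => by
    rw [hloc₁ σ]
    exact hdiag σ
  have hcont : Continuous fun σ => (P⁻¹ * ρ₁.toLocal v σ * P).val :=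
    Units.continuous_val.comp
      ((continuous_const.mul (map_continuous (ρ₁.toLocal v))).mul continuous_const)
  refine ⟨ρ₁, ρ', Hm, n * m, hNpos, hmap, hopen, hred1, hroots', hodd, hHmopen, hindex, hkerle,
    hdg', had', P, χ₁, χ₂, hdiag', fun σ => ?_, fun σ => ?_, ?_, ?_⟩
  · obtain ⟨h1, h2'⟩ := hpow σ
    refine ⟨?_, ?_⟩
    · rw [show 2 * (n * m) = 2 * n * m by ring, pow_mul, h1, one_pow]
    · rw [show 2 * (n * m) = 2 * n * m by ring, pow_mul, h2', one_pow]
  · rw [← hconj σ]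
    exact hresid σ
  · refine (hcont.matrix_elem 0 0).congr fun σ => ?_
    rw [hdiag' σ]
    simp [Matrix.diagonal]
  · refine (hcont.matrix_elem 1 1).congr fun σ => ?_
    rw [hdiag' σ]
    simp [Matrix.diagonal]

/-- **Allen's Lemma 87, Galois side at `p = 2` over `ℚ`, unconditionally, with the induced
structure exported**: `FramedGaloisRep.exists_odd_monomial_artinLift_diagonal_of_isSolvable_two_of_exists_twistChar`
with `hAT` discharged by `exists_twistChar_rat`.
[cite: Allen2014, Lemma 87 (arXiv:1301.1113, §5.1.1, pp. 69–70)] -/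
theorem FramedGaloisRep.exists_odd_monomial_artinLift_diagonal_of_isSolvable_two_rat
    (ρ : FramedGaloisRep ℚ (PadicAlgCl 2) 2) (hres : ρ.IsResiduallyAbsIrreducible)
    (hsol : IsSolvable ρ.residualRep.range) (v : HeightOneSpectrum (𝓞 ℚ))
    (Qv : GL (Fin 2) (padicAlgClResidueField 2))
    (hQv : ∀ σ, (conjGL Qv (ρ.residualRep.comp
      (absGaloisRestrict ℚ (v.adicCompletion ℚ)).toMonoidHom) σ).val 1 0 = 0) :
    ∃ (ρ₁ : FramedGaloisRep ℚ (PadicAlgCl 2) 2)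
      (ρ₀' : absoluteGaloisGroup ℚ →* GL (Fin 2) (padicAlgClIntegers 2))
      (Hm : Subgroup (absoluteGaloisGroup ℚ)) (N : ℕ), 0 < N ∧
      (∀ σ, Matrix.GeneralLinearGroup.map (padicAlgClIntegers 2).subtype (ρ₀' σ) = ρ₁ σ) ∧
      IsOpen ((ρ₁ : absoluteGaloisGroup ℚ →* GL (Fin 2) (PadicAlgCl 2)).ker :
        Set (absoluteGaloisGroup ℚ)) ∧
      ρ₁.IsReductionOf (RingHom.id _) ρ.residualRep ∧
      (∀ σ i j, (ρ₀' σ).val i j = 0 ∨ ((ρ₀' σ).val i j : PadicAlgCl 2) ^ N = 1) ∧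
      ρ₁.IsOdd ∧
      IsOpen (Hm : Set (absoluteGaloisGroup ℚ)) ∧ Hm.index = 2 ∧ ρ.residualRep.ker ≤ Hm ∧
      (∀ h ∈ Hm, (ρ₀' h).val 0 1 = 0 ∧ (ρ₀' h).val 1 0 = 0) ∧
      (∀ g ∉ Hm, (ρ₀' g).val 0 0 = 0 ∧ (ρ₀' g).val 1 1 = 0) ∧
      ∃ (P : GL (Fin 2) (PadicAlgCl 2))
        (χ₁ χ₂ : absoluteGaloisGroup (v.adicCompletion ℚ) →* padicAlgClIntegers 2),
        (∀ σ, (P⁻¹ * ρ₁.toLocal v σ * P).val =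
          Matrix.diagonal ![(χ₁ σ : PadicAlgCl 2), (χ₂ σ : PadicAlgCl 2)]) ∧
        (∀ σ, (χ₁ σ : PadicAlgCl 2) ^ (2 * N) = 1 ∧ (χ₂ σ : PadicAlgCl 2) ^ (2 * N) = 1) ∧
        (∀ σ, residue (padicAlgClIntegers 2) (χ₁ σ) =
            (conjGL Qv (ρ.residualRep.comp
              (absGaloisRestrict ℚ (v.adicCompletion ℚ)).toMonoidHom) σ).val 0 0 ∧
          residue (padicAlgClIntegers 2) (χ₂ σ) =
            (conjGL Qv (ρ.residualRep.comp
              (absGaloisRestrict ℚ (v.adicCompletion ℚ)).toMonoidHom) σ).val 1 1) ∧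
        Continuous (fun σ => (χ₁ σ : PadicAlgCl 2)) ∧
        Continuous (fun σ => (χ₂ σ : PadicAlgCl 2)) :=
  ρ.exists_odd_monomial_artinLift_diagonal_of_isSolvable_two_of_exists_twistChar hres hsol v Qv
    hQv (fun Hm c₀ hopen' hc₀ h2 => exists_twistChar_rat v Hm c₀ hopen' hc₀ h2)

/-- The same from hypotheses (2) and (4) of Allen's Introduction Theorem over `ℚ` (near-ordinarity
at `v` supplies the triangular form of `ρ̄|_{Γ_{ℚ_v}}`,
`FramedGaloisRep.IsOrdinaryOfWeightAt.hasCommonEigenvector_residualRep_comp`).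
[cite: Allen2014, Lemma 87 and the preceding paragraph (arXiv:1301.1113, §5.1.1, pp. 69–70)] -/
theorem FramedGaloisRep.exists_odd_monomial_artinLift_diagonal_of_isOrdinaryOfWeightAt_two_rat
    (ρ : FramedGaloisRep ℚ (PadicAlgCl 2) 2) (hres : ρ.IsResiduallyAbsIrreducible)
    (hsol : IsSolvable ρ.residualRep.range) (v : HeightOneSpectrum (𝓞 ℚ)) {k m : ℕ}
    (hord : FramedGaloisRep.IsOrdinaryOfWeightAt 2 ρ v k m) :
    ∃ (ρ₁ : FramedGaloisRep ℚ (PadicAlgCl 2) 2)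
      (ρ₀' : absoluteGaloisGroup ℚ →* GL (Fin 2) (padicAlgClIntegers 2))
      (Hm : Subgroup (absoluteGaloisGroup ℚ)) (N : ℕ), 0 < N ∧
      (∀ σ, Matrix.GeneralLinearGroup.map (padicAlgClIntegers 2).subtype (ρ₀' σ) = ρ₁ σ) ∧
      IsOpen ((ρ₁ : absoluteGaloisGroup ℚ →* GL (Fin 2) (PadicAlgCl 2)).ker :
        Set (absoluteGaloisGroup ℚ)) ∧
      ρ₁.IsReductionOf (RingHom.id _) ρ.residualRep ∧
      (∀ σ i j, (ρ₀' σ).val i j = 0 ∨ ((ρ₀' σ).val i j : PadicAlgCl 2) ^ N = 1) ∧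
      ρ₁.IsOdd ∧
      IsOpen (Hm : Set (absoluteGaloisGroup ℚ)) ∧ Hm.index = 2 ∧ ρ.residualRep.ker ≤ Hm ∧
      (∀ h ∈ Hm, (ρ₀' h).val 0 1 = 0 ∧ (ρ₀' h).val 1 0 = 0) ∧
      (∀ g ∉ Hm, (ρ₀' g).val 0 0 = 0 ∧ (ρ₀' g).val 1 1 = 0) ∧
      ∃ (Q : GL (Fin 2) (padicAlgClResidueField 2)) (P : GL (Fin 2) (PadicAlgCl 2))
        (χ₁ χ₂ : absoluteGaloisGroup (v.adicCompletion ℚ) →* padicAlgClIntegers 2),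
        (∀ σ, (conjGL Q (ρ.residualRep.comp
          (absGaloisRestrict ℚ (v.adicCompletion ℚ)).toMonoidHom) σ).val 1 0 = 0) ∧
        (∀ σ, (P⁻¹ * ρ₁.toLocal v σ * P).val =
          Matrix.diagonal ![(χ₁ σ : PadicAlgCl 2), (χ₂ σ : PadicAlgCl 2)]) ∧
        (∀ σ, (χ₁ σ : PadicAlgCl 2) ^ (2 * N) = 1 ∧ (χ₂ σ : PadicAlgCl 2) ^ (2 * N) = 1) ∧
        (∀ σ, residue (padicAlgClIntegers 2) (χ₁ σ) =
            (conjGL Q (ρ.residualRep.comp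
              (absGaloisRestrict ℚ (v.adicCompletion ℚ)).toMonoidHom) σ).val 0 0 ∧
          residue (padicAlgClIntegers 2) (χ₂ σ) =
            (conjGL Q (ρ.residualRep.comp
              (absGaloisRestrict ℚ (v.adicCompletion ℚ)).toMonoidHom) σ).val 1 1) ∧
        Continuous (fun σ => (χ₁ σ : PadicAlgCl 2)) ∧
        Continuous (fun σ => (χ₂ σ : PadicAlgCl 2)) := by
  obtain ⟨R, hR⟩ :=
    hord.hasCommonEigenvector_residualRep_comp.exists_conjGL_apply_one_zero_eq_zero
  obtain ⟨ρ₁, ρ₀', Hm, N, hN, hmap, hopen, hred, hroots, hodd, hHo, hHi, hHk, hdg, had, P, χ₁, χ₂,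
    h1, h2, h3, h4, h5⟩ :=
    ρ.exists_odd_monomial_artinLift_diagonal_of_isSolvable_two_rat hres hsol v R⁻¹ hR
  exact ⟨ρ₁, ρ₀', Hm, N, hN, hmap, hopen, hred, hroots, hodd, hHo, hHi, hHk, hdg, had, R⁻¹, P,
    χ₁, χ₂, hR, h1, h2, h3, h4, h5⟩

/-! ### The odd order of the local characters on `G_L`, exported -/

/-- **Allen's Lemma 87, Galois side at `p = 2`, modulo `hAT` — induced structure AND the odd
order of the local characters on `G_L` exported.**  Same statement and proof as
`FramedGaloisRep.exists_odd_monomial_artinLift_diagonal_of_isSolvable_two_of_exists_twistChar`,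
recording in addition an ODD `n₀` (the order of the Teichmüller roots of unity, prime to `p = 2`)
such that the diagonal characters `χ'_v, χ_v` of `ρ₁|_{Γ_{K_v}}` take values in `μ_{n₀}` on
`res⁻¹(Hm) = Γ_{K_v} ∩ G_L`: there the twist `ξ` is trivial and `ρ₁` is the Teichmüller lift
`Ind χ` itself, whose entries are `0` or odd-order roots of unity ("Let `χ` denote the Teichmuller
lift of `χ̄` … because `ξ` is trivial at any place above `2` we have `ρ₁|_{G_v} ≅ (χ'_v 0 ; 0 χ_v)`",
p. 70).  At `p = 2` this is what makes `ρ₁` UNRAMIFIED at `v` whenever the inertia group of `K_v`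
lands in `G_L` (odd-order abelian characters of `Γ_{ℚ₂}` are unramified,
`adicCompletion_rat_eq_one_of_mem_absInertia_of_odd`).
[cite: Allen2014, Lemma 87 (arXiv:1301.1113, §5.1.1, pp. 69–70)] -/
theorem FramedGaloisRep.exists_odd_monomial_artinLift_diagonal_oddOrder_of_isSolvable_two_of_exists_twistChar
    (ρ : FramedGaloisRep K (PadicAlgCl 2) 2) (hres : ρ.IsResiduallyAbsIrreducible)
    (hsol : IsSolvable ρ.residualRep.range) (v : HeightOneSpectrum (𝓞 K))
    (Qv : GL (Fin 2) (padicAlgClResidueField 2))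
    (hQv : ∀ σ, (conjGL Qv (ρ.residualRep.comp
      (absGaloisRestrict K (v.adicCompletion K)).toMonoidHom) σ).val 1 0 = 0)
    (hAT : ∀ (Hm : Subgroup (absoluteGaloisGroup K)) (c₀ : absoluteGaloisGroup K),
      IsOpen (Hm : Set (absoluteGaloisGroup K)) → c₀ ∉ Hm →
      (∀ g g', g ∉ Hm → g' ∉ Hm → g * g' ∈ Hm) →
      ∃ (ξ : absoluteGaloisGroup K → padicAlgClIntegers 2) (m : ℕ), 0 < m ∧
        (∀ x ∈ Hm, ∀ y ∈ Hm, ξ (x * y) = ξ x * ξ y) ∧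
        (∀ x ∈ Hm, (ξ x : PadicAlgCl 2) ^ m = 1) ∧
        (∀ x ∈ Hm, residue (padicAlgClIntegers 2) (ξ x) = 1) ∧
        (∃ N : Subgroup (absoluteGaloisGroup K), N.Normal ∧
          IsOpen (N : Set (absoluteGaloisGroup K)) ∧ ∀ g ∈ N, g ∈ Hm ∧ ξ g = 1) ∧
        (∀ φ : K →+* ℝ, ∃ c : absoluteGaloisGroup K, IsComplexConjugation φ c ∧
          (c ∈ Hm → (ξ c : PadicAlgCl 2) * (ξ (c₀⁻¹ * c * c₀) : PadicAlgCl 2) = -1)) ∧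
        (∀ σ, absGaloisRestrict K (v.adicCompletion K) σ ∈ Hm →
          ξ (absGaloisRestrict K (v.adicCompletion K) σ) = 1) ∧
        (∀ σ, c₀⁻¹ * absGaloisRestrict K (v.adicCompletion K) σ * c₀ ∈ Hm →
          ξ (c₀⁻¹ * absGaloisRestrict K (v.adicCompletion K) σ * c₀) = 1)) :
    ∃ (ρ₁ : FramedGaloisRep K (PadicAlgCl 2) 2)
      (ρ₀' : absoluteGaloisGroup K →* GL (Fin 2) (padicAlgClIntegers 2))
      (Hm : Subgroup (absoluteGaloisGroup K)) (N : ℕ), 0 < N ∧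
      (∀ σ, Matrix.GeneralLinearGroup.map (padicAlgClIntegers 2).subtype (ρ₀' σ) = ρ₁ σ) ∧
      IsOpen ((ρ₁ : absoluteGaloisGroup K →* GL (Fin 2) (PadicAlgCl 2)).ker :
        Set (absoluteGaloisGroup K)) ∧
      ρ₁.IsReductionOf (RingHom.id _) ρ.residualRep ∧
      (∀ σ i j, (ρ₀' σ).val i j = 0 ∨ ((ρ₀' σ).val i j : PadicAlgCl 2) ^ N = 1) ∧
      ρ₁.IsOdd ∧
      IsOpen (Hm : Set (absoluteGaloisGroup K)) ∧ Hm.index = 2 ∧ ρ.residualRep.ker ≤ Hm ∧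
      (∀ h ∈ Hm, (ρ₀' h).val 0 1 = 0 ∧ (ρ₀' h).val 1 0 = 0) ∧
      (∀ g ∉ Hm, (ρ₀' g).val 0 0 = 0 ∧ (ρ₀' g).val 1 1 = 0) ∧
      ∃ (P : GL (Fin 2) (PadicAlgCl 2))
        (χ₁ χ₂ : absoluteGaloisGroup (v.adicCompletion K) →* padicAlgClIntegers 2),
        (∀ σ, (P⁻¹ * ρ₁.toLocal v σ * P).val =
          Matrix.diagonal ![(χ₁ σ : PadicAlgCl 2), (χ₂ σ : PadicAlgCl 2)]) ∧
        (∀ σ, (χ₁ σ : PadicAlgCl 2) ^ (2 * N) = 1 ∧ (χ₂ σ : PadicAlgCl 2) ^ (2 * N) = 1) ∧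
        (∃ n₀ : ℕ, 0 < n₀ ∧ ¬ 2 ∣ n₀ ∧
          ∀ σ, absGaloisRestrict K (v.adicCompletion K) σ ∈ Hm →
            (χ₁ σ : PadicAlgCl 2) ^ n₀ = 1 ∧ (χ₂ σ : PadicAlgCl 2) ^ n₀ = 1) ∧
        (∀ σ, residue (padicAlgClIntegers 2) (χ₁ σ) =
            (conjGL Qv (ρ.residualRep.comp
              (absGaloisRestrict K (v.adicCompletion K)).toMonoidHom) σ).val 0 0 ∧
          residue (padicAlgClIntegers 2) (χ₂ σ) =
            (conjGL Qv (ρ.residualRep.comp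
              (absGaloisRestrict K (v.adicCompletion K)).toMonoidHom) σ).val 1 1) ∧
        Continuous (fun σ => (χ₁ σ : PadicAlgCl 2)) ∧
        Continuous (fun σ => (χ₂ σ : PadicAlgCl 2)) := by
  obtain ⟨hspec, hfin, hce, hdih⟩ := ρ.isDihedralType_residualRep_of_isSolvable_two hres hsol
  haveI := hfin
  obtain ⟨ρ₀, Q, n, Hm, c₁, hn0, hn, hker, hQ, hroots, hshape, hc₁, h2, hkerle, hmem, hdg, had⟩ :=
    exists_teichmullerLift_of_isDihedralType_subgroup ρ.residualRep hce hdih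
  -- the coset representative: in the decomposition group at `v` if possible
  obtain ⟨c₀, hc₀, hsplit⟩ : ∃ c₀, c₀ ∉ Hm ∧
      ((∀ σ, absGaloisRestrict K (v.adicCompletion K) σ ∈ Hm) ∨
        ∃ σ₀, absGaloisRestrict K (v.adicCompletion K) σ₀ = c₀) := by
    by_cases hall : ∀ σ, absGaloisRestrict K (v.adicCompletion K) σ ∈ Hm
    · exact ⟨c₁, hc₁, Or.inl hall⟩
    · push Not at hall
      obtain ⟨σ₀, hσ₀⟩ := hall
      exact ⟨_, hσ₀, Or.inr ⟨σ₀, rfl⟩⟩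
  -- `Hm` is open (it contains the open kernel of `ρ̄`)
  have hopenker : IsOpen (ρ.residualRep.ker : Set (absoluteGaloisGroup K)) :=
    FramedGaloisRep.isOpen_ker_of_isResidualRepOf hspec
  have hHmopen : IsOpen (Hm : Set (absoluteGaloisGroup K)) := Subgroup.isOpen_mono hkerle hopenker
  have hopen0 : IsOpen (ρ₀.ker : Set (absoluteGaloisGroup K)) := by rwa [hker]
  -- the twisting character and the twist
  obtain ⟨ξ, m, hm0, hξ, hξm, hξres, hξN, hξodd, hξf, hξf'⟩ := hAT Hm c₀ hHmopen hc₀ h2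
  obtain ⟨ρ', ρ₁, hmap, hopen, hρ, hρ', hredeq, hroots', hdet, hloc⟩ :=
    FramedGaloisRep.exists_twist_artinLift ρ₀ hopen0 Hm c₀ hc₀ h2 hdg had hm0 hroots ξ hξ hξm
      hξres hξN
  -- the exported structure: index two, monomial shape of the twist
  have hindex : Hm.index = 2 := by
    rw [Subgroup.index_eq_two_iff]
    refine ⟨c₀, fun b => ?_⟩
    by_cases hb : b ∈ Hm
    · exact Or.inr ⟨hb, fun h => hc₀ (by simpa using Hm.mul_mem (Hm.inv_mem hb) h)⟩
    · exact Or.inl ⟨h2 _ _ hb hc₀, hb⟩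
  have hdg' : ∀ h ∈ Hm, (ρ' h).val 0 1 = 0 ∧ (ρ' h).val 1 0 = 0 := fun h hh => by
    obtain ⟨h01, h10⟩ := hdg h hh
    simp only [hρ h hh, Matrix.diagonal_mul, h01, h10, mul_zero, and_self]
  have had' : ∀ g ∉ Hm, (ρ' g).val 0 0 = 0 ∧ (ρ' g).val 1 1 = 0 := fun g hg => by
    obtain ⟨h00, h11⟩ := had g hg
    simp only [hρ' g hg, Matrix.diagonal_mul, h00, h11, mul_zero, and_self]
  have hred1 : ρ₁.IsReductionOf (RingHom.id _) ρ.residualRep :=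
    ⟨ρ', Q, ⟨1, fun σ => by rw [inv_one, one_mul, mul_one]; exact hmap σ⟩,
      fun g => by rw [hredeq]; exact hQ g⟩
  have hNpos : 0 < n * m := Nat.mul_pos hn0 hm0
  -- oddness
  have hodd : ρ₁.IsOdd := by
    intro φ c' hcc'
    -- reduce to the complex conjugation `c` for `φ` provided by `hAT` (all are conjugate)
    obtain ⟨c, hcc, hcodd⟩ := hξodd φ
    obtain ⟨γ, hγ⟩ := isConj_iff.mp (hcc.isConj hcc')
    rw [← hγ, map_mul, map_mul, map_inv, map_mul, map_mul, map_inv,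
      mul_comm (Matrix.GeneralLinearGroup.det (ρ₁ γ)) (Matrix.GeneralLinearGroup.det (ρ₁ c)),
      mul_inv_cancel_right]
    by_cases hc : c ∈ Hm
    · -- `c ∈ G_L`: `ρ₀(c) = 1`, and `det ρ₁(c) = ξ(c) ξ(c₀⁻¹ c c₀) = -1`
      have hc2 : ρ₀ c * ρ₀ c = 1 := by rw [← map_mul, ← sq, hcc.sq_eq_one, map_one]
      obtain ⟨h01, h10⟩ := hdg c hc
      have hdetO : (ρ₀ c).val 0 0 * (ρ₀ c).val 1 1 ≠ 0 := by
        intro h0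
        have hu := (ρ₀ c).isUnit.map Matrix.detMonoidHom
        rw [Matrix.coe_detMonoidHom, Matrix.det_fin_two, h01, zero_mul, sub_zero, h0] at hu
        exact not_isUnit_zero hu
      have hsq0 : ((ρ₀ c).val 0 0 : PadicAlgCl 2) ^ 2 = 1 := by
        have e := congrArg (fun M : GL (Fin 2) (padicAlgClIntegers 2) =>
          (M.val 0 0 : PadicAlgCl 2)) hc2
        simp only [Units.val_mul, Units.val_one, Matrix.mul_apply, Fin.sum_univ_two, h01,
          zero_mul, add_zero, Matrix.one_apply_eq, OneMemClass.coe_one, MulMemClass.coe_mul] at e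
        rw [pow_two]
        exact e
      have hsq1 : ((ρ₀ c).val 1 1 : PadicAlgCl 2) ^ 2 = 1 := by
        have e := congrArg (fun M : GL (Fin 2) (padicAlgClIntegers 2) =>
          (M.val 1 1 : PadicAlgCl 2)) hc2
        simp only [Units.val_mul, Units.val_one, Matrix.mul_apply, Fin.sum_univ_two, h10,
          zero_mul, zero_add, Matrix.one_apply_eq, OneMemClass.coe_one, MulMemClass.coe_mul] at e
        rw [pow_two]
        exact e
      have hg2 : n.gcd 2 = 1 := ((Nat.Prime.coprime_iff_not_dvd Nat.prime_two).2 hn).symm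
      have hone0 : ((ρ₀ c).val 0 0 : PadicAlgCl 2) = 1 := by
        have hni : ((ρ₀ c).val 0 0 : PadicAlgCl 2) ^ n = 1 :=
          (hroots c 0 0).resolve_left fun h0 => hdetO (by rw [h0, zero_mul])
        have h := (pow_gcd_eq_one (m := n) (n := 2)).mpr ⟨hni, hsq0⟩
        rwa [hg2, pow_one] at h
      have hone1 : ((ρ₀ c).val 1 1 : PadicAlgCl 2) = 1 := by
        have hni : ((ρ₀ c).val 1 1 : PadicAlgCl 2) ^ n = 1 :=
          (hroots c 1 1).resolve_left fun h0 => hdetO (by rw [h0, mul_zero])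
        have h := (pow_gcd_eq_one (m := n) (n := 2)).mpr ⟨hni, hsq1⟩
        rwa [hg2, pow_one] at h
      have hdet1 : (((ρ₀ c).val.det : padicAlgClIntegers 2) : PadicAlgCl 2) = 1 := by
        rw [Matrix.det_fin_two, h01, zero_mul, sub_zero, MulMemClass.coe_mul, hone0, hone1,
          mul_one]
      refine Units.ext ?_
      rw [hdet c hc, hdet1, mul_one, hcodd hc, Units.val_neg, Units.val_one]
    · -- `c ∉ G_L`: `ρ̄(c) ≠ 1` and the involution argument
      refine ρ₁.det_eq_neg_one_of_isReductionOf_ne_one_two hred1 hcc fun h1 => ?_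
      have had' : GL2.IsAd (integralReduction (RingHom.id _) ρ₀ c).val :=
        (hshape c).resolve_left ((hmem c).not.1 hc)
      have e : integralReduction (RingHom.id _) ρ₀ c = 1 := by
        have h := hQ c
        rw [h1] at h
        -- `1 = Q * red c * Q⁻¹`
        calc integralReduction (RingHom.id _) ρ₀ c
            = Q⁻¹ * (Q * integralReduction (RingHom.id _) ρ₀ c * Q⁻¹) * Q := by group
          _ = 1 := by rw [← h, mul_one, inv_mul_cancel]
      have h00 := had'.1
      rw [e, Units.val_one, Matrix.one_apply_eq] at h00
      exact one_ne_zero h00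
  -- the local shape: the twist agrees with `ρ₀` on `Γ_{K_v}`, where Theorem A applies
  have hcomp := hloc v hξf hξf' hsplit
  have hconj : ∀ σ,
      conjGL (Qv * Q) ((integralReduction (RingHom.id _) ρ₀).comp
        (absGaloisRestrict K (v.adicCompletion K)).toMonoidHom) σ =
      conjGL Qv (ρ.residualRep.comp (absGaloisRestrict K (v.adicCompletion K)).toMonoidHom) σ := by
    intro σ
    rw [conjGL_apply, conjGL_apply, MonoidHom.comp_apply, MonoidHom.comp_apply, hQ]
    group
  have hQ' : ∀ σ, (conjGL (Qv * Q) ((integralReduction (RingHom.id _) ρ₀).comp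
      (absGaloisRestrict K (v.adicCompletion K)).toMonoidHom) σ).val 1 0 = 0 := fun σ => by
    rw [hconj σ]
    exact hQv σ
  obtain ⟨P, χ₁, χ₂, hdiag, hpow, hresid⟩ := exists_conjGL_diagonal_comp_of_monomial hn0 hn ρ₀
    hroots hshape (absGaloisRestrict K (v.adicCompletion K)).toMonoidHom (Qv * Q) hQ'
  have hloc₁ : ∀ σ, ρ₁.toLocal v σ =
      Matrix.GeneralLinearGroup.map (padicAlgClIntegers 2).subtype
        (ρ₀ ((absGaloisRestrict K (v.adicCompletion K)).toMonoidHom σ)) := by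
    intro σ
    rw [FramedGaloisRep.toLocal_apply, ← hmap]
    have e := congrArg (fun ψ : absoluteGaloisGroup (v.adicCompletion K) →*
      GL (Fin 2) (padicAlgClIntegers 2) => ψ σ) hcomp
    simp only [MonoidHom.comp_apply] at e
    rw [← e]
    rfl
  have hdiag' : ∀ σ, (P⁻¹ * ρ₁.toLocal v σ * P).val =
      Matrix.diagonal ![(χ₁ σ : PadicAlgCl 2), (χ₂ σ : PadicAlgCl 2)] := fun σ => by
    rw [hloc₁ σ]
    exact hdiag σ
  have hcont : Continuous fun σ => (P⁻¹ * ρ₁.toLocal v σ * P).val :=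
    Units.continuous_val.comp
      ((continuous_const.mul (map_continuous (ρ₁.toLocal v))).mul continuous_const)
  -- the odd order of `χ₁, χ₂` on `res⁻¹(Hm)`: there `ρ₀` is diagonal with entries in `μ_n`
  have hoddpow : ∀ σ, absGaloisRestrict K (v.adicCompletion K) σ ∈ Hm →
      (χ₁ σ : PadicAlgCl 2) ^ n = 1 ∧ (χ₂ σ : PadicAlgCl 2) ^ n = 1 := by
    intro σ hσ
    set h := absGaloisRestrict K (v.adicCompletion K) σ with hh
    obtain ⟨h01, h10⟩ := hdg h hσ
    have hdetO : (ρ₀ h).val 0 0 * (ρ₀ h).val 1 1 ≠ 0 := by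
      intro h0
      have hu := (ρ₀ h).isUnit.map Matrix.detMonoidHom
      rw [Matrix.coe_detMonoidHom, Matrix.det_fin_two, h01, zero_mul, sub_zero, h0] at hu
      exact not_isUnit_zero hu
    have ha : ((ρ₀ h).val 0 0 : PadicAlgCl 2) ^ n = 1 :=
      (hroots h 0 0).resolve_left fun h0 => hdetO (by rw [h0, zero_mul])
    have hd : ((ρ₀ h).val 1 1 : PadicAlgCl 2) ^ n = 1 :=
      (hroots h 1 1).resolve_left fun h0 => hdetO (by rw [h0, mul_zero])
    -- characteristic polynomials: `(X - χ₁)(X - χ₂) = (X - a)(X - d)`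
    have hM : (Matrix.GeneralLinearGroup.map (padicAlgClIntegers 2).subtype (ρ₀ h)).val =
        Matrix.diagonal ![((ρ₀ h).val 0 0 : PadicAlgCl 2), ((ρ₀ h).val 1 1 : PadicAlgCl 2)] := by
      ext i j
      fin_cases i <;> fin_cases j <;>
        simp [Matrix.GeneralLinearGroup.map_apply, Matrix.diagonal, h01, h10]
    have hc1 : (Matrix.GeneralLinearGroup.map (padicAlgClIntegers 2).subtype (ρ₀ h)).val.charpoly =
        (Polynomial.X - Polynomial.C ((ρ₀ h).val 0 0 : PadicAlgCl 2)) *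
          (Polynomial.X - Polynomial.C ((ρ₀ h).val 1 1 : PadicAlgCl 2)) := by
      rw [hM, Matrix.charpoly_diagonal, Fin.prod_univ_two]
      simp
    have hc2 : (Matrix.GeneralLinearGroup.map (padicAlgClIntegers 2).subtype (ρ₀ h)).val.charpoly =
        (Polynomial.X - Polynomial.C (χ₁ σ : PadicAlgCl 2)) *
          (Polynomial.X - Polynomial.C (χ₂ σ : PadicAlgCl 2)) := by
      have e : (Matrix.GeneralLinearGroup.map (padicAlgClIntegers 2).subtype (ρ₀ h)).val =
          (P * (P⁻¹ * Matrix.GeneralLinearGroup.map (padicAlgClIntegers 2).subtype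
            (ρ₀ ((absGaloisRestrict K (v.adicCompletion K)).toMonoidHom σ)) * P) * P⁻¹ :
              GL (Fin 2) (PadicAlgCl 2)).val := by
        have eh : (absGaloisRestrict K (v.adicCompletion K)).toMonoidHom σ = h := rfl
        rw [eh]
        congr 1
        group
      rw [e, Units.val_mul, Units.val_mul, Matrix.coe_units_inv, Matrix.charpoly_units_conj, hdiag σ,
        Matrix.charpoly_diagonal, Fin.prod_univ_two]
      simp
    rcases eq_and_eq_or_eq_and_eq_of_mul_X_sub_C_eq (hc2.symm.trans hc1) with ⟨e1, e2⟩ | ⟨e1, e2⟩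
    · exact ⟨by rw [e1, ha], by rw [e2, hd]⟩
    · exact ⟨by rw [e1, hd], by rw [e2, ha]⟩
  refine ⟨ρ₁, ρ', Hm, n * m, hNpos, hmap, hopen, hred1, hroots', hodd, hHmopen, hindex, hkerle,
    hdg', had', P, χ₁, χ₂, hdiag', fun σ => ?_, ⟨n, hn0, hn, hoddpow⟩, fun σ => ?_, ?_, ?_⟩
  · obtain ⟨h1, h2'⟩ := hpow σ
    refine ⟨?_, ?_⟩
    · rw [show 2 * (n * m) = 2 * n * m by ring, pow_mul, h1, one_pow]
    · rw [show 2 * (n * m) = 2 * n * m by ring, pow_mul, h2', one_pow]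
  · rw [← hconj σ]
    exact hresid σ
  · refine (hcont.matrix_elem 0 0).congr fun σ => ?_
    rw [hdiag' σ]
    simp [Matrix.diagonal]
  · refine (hcont.matrix_elem 1 1).congr fun σ => ?_
    rw [hdiag' σ]
    simp [Matrix.diagonal]


/-- The same over `ℚ`, unconditionally (`hAT` discharged by `exists_twistChar_rat`), with the odd
order of `χ'_v, χ_v` on `res⁻¹(Hm)` exported.
[cite: Allen2014, Lemma 87 (arXiv:1301.1113, §5.1.1, pp. 69–70)] -/
theorem FramedGaloisRep.exists_odd_monomial_artinLift_diagonal_oddOrder_of_isSolvable_two_rat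
    (ρ : FramedGaloisRep ℚ (PadicAlgCl 2) 2) (hres : ρ.IsResiduallyAbsIrreducible)
    (hsol : IsSolvable ρ.residualRep.range) (v : HeightOneSpectrum (𝓞 ℚ))
    (Qv : GL (Fin 2) (padicAlgClResidueField 2))
    (hQv : ∀ σ, (conjGL Qv (ρ.residualRep.comp
      (absGaloisRestrict ℚ (v.adicCompletion ℚ)).toMonoidHom) σ).val 1 0 = 0) :
    ∃ (ρ₁ : FramedGaloisRep ℚ (PadicAlgCl 2) 2)
      (ρ₀' : absoluteGaloisGroup ℚ →* GL (Fin 2) (padicAlgClIntegers 2))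
      (Hm : Subgroup (absoluteGaloisGroup ℚ)) (N : ℕ), 0 < N ∧
      (∀ σ, Matrix.GeneralLinearGroup.map (padicAlgClIntegers 2).subtype (ρ₀' σ) = ρ₁ σ) ∧
      IsOpen ((ρ₁ : absoluteGaloisGroup ℚ →* GL (Fin 2) (PadicAlgCl 2)).ker :
        Set (absoluteGaloisGroup ℚ)) ∧
      ρ₁.IsReductionOf (RingHom.id _) ρ.residualRep ∧
      (∀ σ i j, (ρ₀' σ).val i j = 0 ∨ ((ρ₀' σ).val i j : PadicAlgCl 2) ^ N = 1) ∧
      ρ₁.IsOdd ∧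
      IsOpen (Hm : Set (absoluteGaloisGroup ℚ)) ∧ Hm.index = 2 ∧ ρ.residualRep.ker ≤ Hm ∧
      (∀ h ∈ Hm, (ρ₀' h).val 0 1 = 0 ∧ (ρ₀' h).val 1 0 = 0) ∧
      (∀ g ∉ Hm, (ρ₀' g).val 0 0 = 0 ∧ (ρ₀' g).val 1 1 = 0) ∧
      ∃ (P : GL (Fin 2) (PadicAlgCl 2))
        (χ₁ χ₂ : absoluteGaloisGroup (v.adicCompletion ℚ) →* padicAlgClIntegers 2),
        (∀ σ, (P⁻¹ * ρ₁.toLocal v σ * P).val =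
          Matrix.diagonal ![(χ₁ σ : PadicAlgCl 2), (χ₂ σ : PadicAlgCl 2)]) ∧
        (∀ σ, (χ₁ σ : PadicAlgCl 2) ^ (2 * N) = 1 ∧ (χ₂ σ : PadicAlgCl 2) ^ (2 * N) = 1) ∧
        (∃ n₀ : ℕ, 0 < n₀ ∧ ¬ 2 ∣ n₀ ∧
          ∀ σ, absGaloisRestrict ℚ (v.adicCompletion ℚ) σ ∈ Hm →
            (χ₁ σ : PadicAlgCl 2) ^ n₀ = 1 ∧ (χ₂ σ : PadicAlgCl 2) ^ n₀ = 1) ∧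
        (∀ σ, residue (padicAlgClIntegers 2) (χ₁ σ) =
            (conjGL Qv (ρ.residualRep.comp
              (absGaloisRestrict ℚ (v.adicCompletion ℚ)).toMonoidHom) σ).val 0 0 ∧
          residue (padicAlgClIntegers 2) (χ₂ σ) =
            (conjGL Qv (ρ.residualRep.comp
              (absGaloisRestrict ℚ (v.adicCompletion ℚ)).toMonoidHom) σ).val 1 1) ∧
        Continuous (fun σ => (χ₁ σ : PadicAlgCl 2)) ∧
        Continuous (fun σ => (χ₂ σ : PadicAlgCl 2)) :=
  ρ.exists_odd_monomial_artinLift_diagonal_oddOrder_of_isSolvable_two_of_exists_twistChar hres hsol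
    v Qv hQv (fun Hm c₀ hopen' hc₀ h2 => exists_twistChar_rat v Hm c₀ hopen' hc₀ h2)

/-- The same from hypotheses (2) and (4) of Allen's Introduction Theorem over `ℚ`, with the odd
order of `χ'_v, χ_v` on `res⁻¹(Hm)` exported.
[cite: Allen2014, Lemma 87 and the preceding paragraph (arXiv:1301.1113, §5.1.1, pp. 69–70)] -/
theorem FramedGaloisRep.exists_odd_monomial_artinLift_diagonal_oddOrder_of_isOrdinaryOfWeightAt_two_rat
    (ρ : FramedGaloisRep ℚ (PadicAlgCl 2) 2) (hres : ρ.IsResiduallyAbsIrreducible)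
    (hsol : IsSolvable ρ.residualRep.range) (v : HeightOneSpectrum (𝓞 ℚ)) {k m : ℕ}
    (hord : FramedGaloisRep.IsOrdinaryOfWeightAt 2 ρ v k m) :
    ∃ (ρ₁ : FramedGaloisRep ℚ (PadicAlgCl 2) 2)
      (ρ₀' : absoluteGaloisGroup ℚ →* GL (Fin 2) (padicAlgClIntegers 2))
      (Hm : Subgroup (absoluteGaloisGroup ℚ)) (N : ℕ), 0 < N ∧
      (∀ σ, Matrix.GeneralLinearGroup.map (padicAlgClIntegers 2).subtype (ρ₀' σ) = ρ₁ σ) ∧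
      IsOpen ((ρ₁ : absoluteGaloisGroup ℚ →* GL (Fin 2) (PadicAlgCl 2)).ker :
        Set (absoluteGaloisGroup ℚ)) ∧
      ρ₁.IsReductionOf (RingHom.id _) ρ.residualRep ∧
      (∀ σ i j, (ρ₀' σ).val i j = 0 ∨ ((ρ₀' σ).val i j : PadicAlgCl 2) ^ N = 1) ∧
      ρ₁.IsOdd ∧
      IsOpen (Hm : Set (absoluteGaloisGroup ℚ)) ∧ Hm.index = 2 ∧ ρ.residualRep.ker ≤ Hm ∧
      (∀ h ∈ Hm, (ρ₀' h).val 0 1 = 0 ∧ (ρ₀' h).val 1 0 = 0) ∧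
      (∀ g ∉ Hm, (ρ₀' g).val 0 0 = 0 ∧ (ρ₀' g).val 1 1 = 0) ∧
      ∃ (Q : GL (Fin 2) (padicAlgClResidueField 2)) (P : GL (Fin 2) (PadicAlgCl 2))
        (χ₁ χ₂ : absoluteGaloisGroup (v.adicCompletion ℚ) →* padicAlgClIntegers 2),
        (∀ σ, (conjGL Q (ρ.residualRep.comp
          (absGaloisRestrict ℚ (v.adicCompletion ℚ)).toMonoidHom) σ).val 1 0 = 0) ∧
        (∀ σ, (P⁻¹ * ρ₁.toLocal v σ * P).val =
          Matrix.diagonal ![(χ₁ σ : PadicAlgCl 2), (χ₂ σ : PadicAlgCl 2)]) ∧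
        (∀ σ, (χ₁ σ : PadicAlgCl 2) ^ (2 * N) = 1 ∧ (χ₂ σ : PadicAlgCl 2) ^ (2 * N) = 1) ∧
        (∃ n₀ : ℕ, 0 < n₀ ∧ ¬ 2 ∣ n₀ ∧
          ∀ σ, absGaloisRestrict ℚ (v.adicCompletion ℚ) σ ∈ Hm →
            (χ₁ σ : PadicAlgCl 2) ^ n₀ = 1 ∧ (χ₂ σ : PadicAlgCl 2) ^ n₀ = 1) ∧
        (∀ σ, residue (padicAlgClIntegers 2) (χ₁ σ) =
            (conjGL Q (ρ.residualRep.comp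
              (absGaloisRestrict ℚ (v.adicCompletion ℚ)).toMonoidHom) σ).val 0 0 ∧
          residue (padicAlgClIntegers 2) (χ₂ σ) =
            (conjGL Q (ρ.residualRep.comp
              (absGaloisRestrict ℚ (v.adicCompletion ℚ)).toMonoidHom) σ).val 1 1) ∧
        Continuous (fun σ => (χ₁ σ : PadicAlgCl 2)) ∧
        Continuous (fun σ => (χ₂ σ : PadicAlgCl 2)) := by
  obtain ⟨R, hR⟩ :=
    hord.hasCommonEigenvector_residualRep_comp.exists_conjGL_apply_one_zero_eq_zero
  obtain ⟨ρ₁, ρ₀', Hm, N, hN, hmap, hopen, hred, hroots, hodd, hHo, hHi, hHk, hdg, had, P, χ₁, χ₂,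
    h1, h2, h25, h3, h4, h5⟩ :=
    ρ.exists_odd_monomial_artinLift_diagonal_oddOrder_of_isSolvable_two_rat hres hsol v R⁻¹ hR
  exact ⟨ρ₁, ρ₀', Hm, N, hN, hmap, hopen, hred, hroots, hodd, hHo, hHi, hHk, hdg, had, R⁻¹, P,
    χ₁, χ₂, hR, h1, h2, h25, h3, h4, h5⟩

end Monomial

end Literature.NumberTheory.GaloisRepresentations

end
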